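import Summits.BirchSwinnertonDyer.Rank1Residual.F1Sign2.SupersingularTowerNormIndexAtTwo
import Summits.BirchSwinnertonDyer.Rank1Residual.F1Sign2.KummerFieldLocal
import Summits.BirchSwinnertonDyer.Rank1Residual.F1Sign2.HalfPeriodWeilPairingAtTwo
import Summits.BirchSwinnertonDyer.Rank1Residual.F1Sign2.SupersingularKummerAtlasAtTwo
import Literature.NumberTheory.DiophantineGeometry.Conductor
import Literature.NumberTheory.EllipticCurves.QuadraticTwist
import Literature.NumberTheory.EllipticCurves.Tamagawa
import Mathlib.NumberTheory.Padics.PadicNumbers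
import HarnessLib.Audit.Tags
import HarnessLib

/-!
# Cell `bsd-f1-sign2` — IMC lens (-imc g19, planner-of-record; MEMO-imc §10.98 + add1–add4; D-imc-55/56): IMC-TK55
# «THE TWISTED KUMMER ATLAS UP THE CYCLOTOMIC ℤ₂-TOWER» (layers `n = 1, 2, 3` of `ℚ_{2,n}`: the Kummer Lagrangians of all
# twists of a good supersingular curve, the TYPE LAW P56T, the blind/sensitive sets P55u1/P55u2/P55d/P56U/P57U/P57O, the
# level-profile candidate P57L, and the global TOWER COMPANION LAW P55a)

STATEMENTS ONLY, typer -ty g17 (port asked by -imc g19, INBOX 2026-08-29T11:07:04Z «CANDIDATES-delta IMC-TK55 + port»; suggested module name -imc's).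
Source: `HOME/MEMO-imc-data/dimc55/lean/Sketch57.lean` **3f58f222255131d0** (340 l.; = `Sketch55.lean` v2 8054c8b18db69094 — itself v1 a2579c7e3bb1e364 farm rc 0
re-based on the landed `F1Sign2/SupersingularKummerAtlasAtTwo.lean` p713130 with the duplicate `AreSupersingularCompanionsAtTwo` dropped — plus the layer-three
block `InUnitFiltrationSqAtTwo` / `IsTypeBlindLevelAtLayerThree` / P57U / P57O / P57L; REF1's copies `HOME/REF1-data/b190/Sketch57.lean`, `Sketch55.lean`, same SHA16s;
-ty farm re-check of `Sketch57.lean` as delivered 2026-08-29T11:5xZ: rc 0, 0 errors, 0 warnings, 0 sorries; REF1's `Probe190.lean` 49e9b6b4c761ff7a farm-run by -ty: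
rc 0, 9 probe sorries, 0 other warnings = the A1 REF1 §190 owed to the farm's return).  Decl bodies VERBATIM and byte-identical to the sketch AND to REF1's copy
(builder-verified): helpers `InKummerPlaneOver`, `KummerImageIsPlaneOver`, `IsCyclotomicLayerAtTwo`, `KummerImagesAgree`, `IsOddClassAtTwo`, `InUnitFiltrationSqAtTwo`,
`IsTypeBlindLevelAtLayerThree`; rows P55u1 `LayerOneOddTwistKummerPlaneAtTwo`, P55u2 `LayerOneKummerPlaneIsRestrictionAtTwo`, P55d
`LayerOneUnitTwistKummerPlaneDichotomyAtTwo`, P55a `TowerCompanionTwoSelmerRankLawAtTwo`, P56T `TowerKummerTypeLawAtTwo (n)`, P56U `LayerTwoTypeBlindUnitClassesAtTwo`,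
P57U `LayerThreeUnitTwistTypeLawAtTwo`, P57O `LayerThreeOddTwistTypeSensitiveAtTwo` (plain `def`s, as -imc typed and asked: data-laws / corollary-of-print rows) and
P57L `TowerUnitTwistLevelLawAtTwo (n)` (`@[conjecture]`: the one conjecture-candidate that survives); docstrings verbatim + one REF1-AUDIT and one REF2-PLACEMENT
rider each; -imc's module docstring reproduced below verbatim (its «CONJECTURE-CANDIDATE (layer two …) Π_{δ₃}(E) is ONE maximal isotropic subspace» paragraph is
the KILLED P55t — kept as -imc's record of the question, see NEGATIVE RECORDS).  Typer key normalisations inside docstrings (text, not bodies): `Cesnavicius2016` →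
`Cesnavicius2016SelmerFlat` (the tree's key for arXiv 1301.4724), the free-form `[folklore: …]` bracket → `[folklore]` + parenthesis.  Imports = the sketch's
(+ `HarnessLib.Audit.Tags` for the tag).  Over tree declarations only: `GoodSS` / `selmerLayer` (`F1Sign2/SupersingularTowerNormIndexAtTwo.lean`), `algK` / `kummerElt`
(`F1Sign2/KummerFieldLocal.lean`, Kummer map PROVED there), `AreSupersingularCompanionsAtTwo` (`F1Sign2/SupersingularKummerAtlasAtTwo.lean`), `nRankAtLeast`
(`Literature/Barriers`), Literature `quadraticTwist`, `frobeniusTrace`, `ZpExtension.IsCyclotomic`, Mathlib `ℚ_[2]`, `Algebra.norm`, `Padic.valuation`.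
Kernel sibling `F1Sign2/TowerKummerAtlasAtTwoKernel.lean`: REF1 §190's three BC7 edge lemmas (`layer_zero_iff`, `kummerImagesAgree_refl`, `not_isOddClass_zero`).

NEGATIVE RECORDS (NOT FILED, by REF1 §190/§190-add ruling «must not be filed as a thesis»): P55t `LayerTwoTowerGeneratorKummerUniversalAtTwo` — KILLED by data
(k56b.gp j329775: the `δ₃ = 2 + c`-twist plane takes two values, 4 480 vs 4 078 curves, confirmed independently by REF1 eng190b, `dim ∩ = 2`); P56S
`OddTwistTypeBlindIffOddLayerAtTwo (n)` «odd-class twists type-blind iff `n` odd» — FALSE at `n = 3` (atlas57.py j330261 and GP k57b.gp j330462: all 512 odd classes of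
`ℚ_{2,3}` type-SENSITIVE; pattern S, B, S, S), killed exactly by its pre-registered falsifier together with REF1 §190 (v)'s fitted rule «sensitive ⟺ f(χ_δ) ≡ 3, 4 (mod 6)»
and REF2 v53 §4 (F3)'s s/Kodaira dictionary (retracted v53 §7.1, TRAP T53-3).  Both names stay citable from these docstrings as the record of the killed candidates.

GRADES (REF1-AUDIT §190 D-imc-55-R1, register l.3477–3486, evidence `HOME/REF1-data/b190/` SHA16.txt — engines `eng190a.py` b2f96752a2dd40f4 (n = 1, power basis of
`ℚ₂(2^{1/6})`), `eng190b.py` 10caea425664749f (n = 2, pairs over it), `tate190.py` a7d5f1aa0310b1c6 (generic Tate's algorithm over `ℤ₂[c_n]`), `census190*.py`; §190-add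
D-imc-56-R1): **P55u1 / P55u2 / P55d / P55a / P56U SURVIVE** (data-laws; REF1 = THIRD independent engine: n = 1 18 curves × 16 classes, n = 2 9 curves × 64 classes,
18 336/18 336 same-plane pairs agree with -imc's SUMMARY-56-py, 22 = 22 planes, 0 violations); **P56T(n) SURVIVES and for `n ≤ 3` is REDUCED TO PRINT + a finite Tate census —
NOT beyond print** (Honda transport: `Ê/ℤ₂` is determined by `a₂` [cite: Honda1970, Thm. 9], Hill 1971 (bib `Hill1971`); the sign of `a₂` is invisible = «[5] ∈ C_n» = [cite: Kramer1981, Prop. 7]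
for `E^{(δ)}` and `d = 5` + cohomological triviality of `A⁰` in unramified extensions [cite: Mazur1972, Cor. 4.2] + Tate's algorithm over `ℤ₂[c_n]` on all 8 + 16 + 64 + 1 024 twist
classes: Kodaira types ∈ {I₀, II, II*, I₀*(c = 2)} ⟹ `i(K_n(√5)/K_n; E^{(δ)}) = 0`; REF1's ℤ₂[C₂]-freeness criterion of §10.98 (4)(i) is an «iff» and holds in every cell); N55 norm
indices CONFIRMED and extended (`dim(Π₁ ∩ Π_δ) = 2ⁿ − i(K_n(√δ)/K_n; E)`: n = 1: i = 0/1/2 on res ℤ₂^× / odd / u⟨−1,5⟩; n = 2: 0/2/3; n = 3: `i(k₄/k₃) = 5 = q₄` on all 512 odd classes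
= equality in [cite: KuriharaOtsuki2006, Prop. 1.4]); engines 1d/2″ frames audited (M₁₂ = ϖ¹² − 3940ϖ⁶ + 2 re-derived by hand; `bid = 𝔭^{2e+1}` the right modulus); (iv) keep the
`∀ φ` inclusion form of `KummerImagesAgree`, NO `Nonempty` hypothesis — but every NEGATED use (P56U's sensitive side, P57U's `←`, P57O) ENTAILS
`Nonempty (algK W₁′ →ₐ[K] algK W₂′)`, i.e. the tower form of P54t `SupersingularCubeRootOfTwoAtTwo` (`algK W′ ≅ K_n(∛2)`: `3 ∤ 2ⁿ`, `ζ₃ ∉ K_n`, `φ` unique) is LOAD-BEARING for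
provers of any sensitivity statement (said in those docstrings); **P57U / P57O SURVIVE** (data-laws, typed faithfully: levels uniformiser-independent, even levels absorbed,
`y = 0` via `Padic.valuation 0 = 0`, `c` forced to be a uniformiser), since -imc §10.98-add4 (INBOX 11:40:11Z) TWO-ENGINE at layer three (GP engine 2‴ `k57b.gp` 4effa72ba758c970
j330462, ideallog frame on `(𝒪_F/𝔭⁴⁹)^×`, vs python engine 1e `atlas57.py` j330261: frame maps rank 10/10 & 26/26, planes AGREE 18 432/18 432 (curve, bucket), DISAGREE 0,
147 456 vectors — the sketch's «ONE ENGINE ONLY at layer three» sentences predate add4); **P57L(n) SURVIVES as conjecture-candidate** (`n ≤ 3` data); P55t, P56S KILLED (above).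
REF1-AUDIT §192 (g18, register tail, evidence `HOME/REF1-data/b192/`: `Probe192.lean` f3fc2078bb57f471 = Sketch57 verbatim + 5 probes + 8 BC7 lemmas, farm rc 0, exactly
5 sorries; farm back: Probe190 rc 0 · 9 sorries = A1 of §190 by farm, Sketch57 rc 0): **P57U / P57O re-scored: SURVIVE as TWO-ENGINE data-laws**, P57L conjecture-candidate,
P56S KILLED-record; BC7 certificates (kernel): octic = `(x² − 2)^{∘3}`, `[1]`/squares on the BLIND side of P57U, `δ = 0` edge, and the JUNK EDGE of `InUnitFiltrationSqAtTwo`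
without a finite `ℚ₂`-basis (`Algebra.norm ℚ_[2] = 1`; harmless under the laws' binders — docstring caveat added); port check of p713640 (IMC-KA54 kernel) CLEAN 21/21.
REF1's surviving structural remarks (offered for O-57u, not laws): Kodaira dictionary of the `n = 3` level sets (`ℓ = 1 ↦ I₀*`, `3 ↦ II*`, `5 ↦ II`, `7 ↦ I₀*`, `9 ↦ II*`, `11 ↦ II`,
`13 ↦ I₀*`, `15 ↦ II*`, `16 ↦ I₀`, odd `↦ II*`); every I₀* unit level set sensitive and every II* unit level set blind (9/9 over `n ≤ 3`), type II undecided.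
REF2-PLACEMENT v53 §4 (43c89a28b8dbd904, D-imc-55-R2) + §7.1–7.3 (24c963c20c23820d, D-imc-56-R2/R5): (F1) the tower Selmer GROWTH vector `(0,1,1,3)` for `a₂ = ±2`,
`ord₂(L(E,1)/Ω_E) = ord₂(Tam E) = 0` IS IN PRINT — [cite: KuriharaOtsuki2006, Thm. 0.1, Prop. 1.1, Cor. 1.2, Prop. 1.4] (`s₂(E/ℚ_n) = q_n = 1, 1, 3, 5, 11`; pre-registered
`s₂(ℚ₄) = 5`); the `a₂ = 0` vector `(0,1,1,5)` is NOT determined in print (KO Rem. 0.2(3)); (F2) the Kodaira types / conductor exponents of EVERY twist `E^{(δ)}/ℚ_{2,n}` are print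
FACTS — layer 0 [cite: BarriosEtAl2025, Thm. 5.1], every layer [cite: WangHaiyang2024, Thm. 1.2] (potentially good-ss via quadratic `L/K`: type II / I₀* / II* by `2s + 3 mod 6`) —
but they are NOT the signed object: the (F3) dictionary «sensitive ⟺ s ≡ 2, 3 (mod 6)» fitted 88/88 on `n ≤ 2` and DIED at `n = 3` (RETRACTED §7.1, TRAP T53-3); (F4) SIGN-BLINDNESS
= component groups: `Π_δ ∩ Π_{5δ} = N(E^{(δ)}(K_n(√5)))` [cite: Kramer1981, Prop. 7], `i = dim Ĥ⁰(Frob, Φ(k_L))` — COROLLARY OF PRINT at layer 0 without cells and wherever the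
twist has type II/II*, one Tamagawa check (`c ≠ 4`) on the I₀*-cosets; parity in print ([cite: DokchitserDokchitser2011, Thm. 24, Thm. 26] Kramer–Tunnell + Ogg–Saito); (F5) N55 /
(N₃) norm-index steps: tower steps in print ([cite: KuriharaOtsuki2006, Prop. 1.4]; layer 0 [cite: Kramer1981, Prop. 4]; composite norm images [cite: Hazewinkel1974NormMapsI, Thm. 6.1];
asymptotics [cite: Kuriya2005, Thm. 1.1, Remark 1.7]); the odd-class EQUALITY `i = q_{n+1}` for every conductor-`(2e+1)` quadratic `L/K_n` and the unit formula `i(f) = 2⌈(f−2)/6⌉`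
are NOT located IN PRINT as statements but = COROLLARY-CANDIDATE OF THE PRINTED METHOD (v53 §7.2-add/add2, D-imc-56-R5 FINAL: Serre, Corps locaux V §3 /
Hazewinkel I §2 / [cite: Kramer1981, Prop. 4] filtration count gives `2⌈(f−2)/6⌉` on units and the Jacobsthal numbers `J_{n+1} = 1, 1, 3, 5, 11, …` on odd classes, type-, class-
and BSD-independent; proof = one Herbrand-quotient page, ask N3-R1; P57N, if -imc types it, carries these closed forms); (F6) layer-parity structures in print = [cite: Kobayashi2003, Def. 8.10, Prop. 8.12, Lemma 8.9] (odd `p`), KO's `q_n`, Sprung ♯/♭ — none about Kummer images of twists;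
O-57u (an upper-break function `V(u)`) is an unplaced OBSERVATION, print-computable for `a₂ = 0` via the Lubin–Tate group of `ℚ₄` for `ϖ = −2` ([cite: Honda1970, Thm. 9],
Hill 1971 (bib `Hill1971`), Lubin–Tate 1965 (bib `LubinTate1965`)).  GRADES OF RECORD: P55u1 / P55u2 / P55d / P56U / P57U / P57O data-laws NOT IN PRINT (galaxy/corpus nulls for twisted Kummer images over
RAMIFIED `ℚ_{2,n}`, §10.98 (6) and v53 §4.1); P56T: a₂-dependence = Honda print, sign-half corollary of print for ALL `n` (REF2 v54 §3.1 ∘ REF1 §204; was `n ≤ 3`); P55a = regression of print (v52 §3.2: Česnavičius (B∞) +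
[cite: MazurRubin2010, Lemma 2.10]; (F1)); P57L conjecture-candidate not in print.  Beyond-print theorem: no.  PARTITION none.  BSD is not proved.
bears_on: stmt-BirchSwinnertonDyer-23715.

## ADD58 — D-imc-57 «LAYER FOUR» (-imc g19 MEMO-imc §10.99 + add1, INBOX 2026-08-29T12:22:50Z; appended by -ty g17 at REF1 g18 §195's un-gating, INBOX 12:32:10Z)
Source: `HOME/MEMO-imc-data/dimc55/lean/Sketch58.lean` **0f61510cbe18b386** (= Sketch57 + the add58 block l.339–405; farm rc 0·0·0·0; -imc's BC7 `Probe58` 6/6 CLEAN) and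
REF1's `HOME/REF1-data/b195/lean/Probe195.lean` **0e2bb122dd50d142** (= Sketch58 VERBATIM + `probe_58U` / `probe_58V` + 11 sorry-free BC7 lemmas; FARM rc 0, exactly 2 sorries).
Appended VERBATIM below the layer-three block (bodies byte-identical to Sketch58 AND Probe195, builder-verified): carriers `IsLeadingOddLevelAtTwo c ℓ δ`,
`IsTypeBlindLevelAtLayerFour c δ`; **P58U `LayerFourUnitTwistTypeLawAtTwo`** (plain def: DATA-LAW, ONE engine — TARGETED GP atlas `atlas4gp/k58.gp` ba5b6e4cff49d238, kit
j330536 19a1 · j330651 35a1 · j330537 67a1 · j330652 11a1; 209 target classes, 170 saturated + 36 by subspace sums + 3 undecided per REF1's recount; fold `FOLD-58-4curves.txt`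
fe4507ca82e7a661: (T₄) type law 170/170, sign-blind 170/170; (S₄) odd classes type-SENSITIVE 27/27, `dim(Π_1 ∩ Π_odd) = 5` ⟹ `i = 11 = J₅`; (U₄) verdict constant per level;
(N₄) `i(f) = 2⌈(f−2)/6⌉` on all 15 unit levels + `i(2) = 0` = REF2 §7.2-add's prediction 16/16); **P58V `TowerTwistConductorLawAtTwo`** (`@[conjecture]` per REF1 R195c:
CONJECTURE-CANDIDATE «on even classes the signed object at 2 is the CONDUCTOR EXPONENT `f = 2e_n + 1 − ℓ(δ)` of the twisting character» — ONE function `V(f)` over layers 0–4,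
no clash on the 8 even `f` shared between layers (21 cells), `V = B` at `f ∈ {0, 2, 5, 6, 8, 9, 14, 20, 26}`, `S` at `f ∈ {3, 4, 10, 12, 16, 17, 18, 22, 24, 28, 30, 32, 33}`;
O-57u (absolute-upper-break reading) KILLED 9/12 by the same data); -imc's words-only P58N comment (cross-layer norm-index law — typing needs the Kummer image as an
`𝔽₂`-subspace, not only `KummerImagesAgree`; left as -imc's comment, not typed here).  GRADES: REF1-AUDIT §195 (D-imc-57-R1, evidence `HOME/REF1-data/b195/`): carriers
CLEAN; **P58U SURVIVES (data-law, one engine)**, **P58V SURVIVES (conjecture-candidate)**; R195a (second engine: saturate `ℓ = 1` — `f = 32` is P58V's boundary case, today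
4/12 full-rank — and ≥ 1 more curve per type), R195b (wording 170 + 36 + 3), R195c (docstring/tag — applied in the riders).  REF2-PLACEMENT v53 §11 (552b5be54d3eb547): (1) the
norm-index mechanism now stands on layers 0–4 with no free parameter (16/16 + `J₅ = 11` pre-registered in §7.2-add/add2 before -imc's k58 run); (2) `V(f)` = **UNPLACED DATA-LAW**
(no print compares twisted Kummer planes of the two height-2 types; searches §11.2); (3) proved corner `i(f) = 0 ⟹ blind` explains `V(0) = V(2) = B`; the `f mod 6` correlate is NOT
a proposed closed form.  Kernel sibling gains REF1 §195's 8 new BC7 certificates.  Beyond-print theorem: no.  PARTITION none.  BSD is not proved.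

## ADD59 — D-imc-58 «THE VALUATION WINDOW / LAYER FIVE / THE [2]-PROFILE» (-imc g19 MEMO-imc §10.99-add3/add4/add5, INBOX 2026-08-29T13:07:29Z / 13:16:06Z / 13:30:29Z; appended by -ty g18 at REF1 g18 §200's port gate, INBOX 13:36:40Z)
Source: `HOME/MEMO-imc-data/dimc55/atlas5/lean/Sketch59.lean` **4cd694cf81b53af2** (142 l.; = REF1's audited 541377e8d466e7be with the local `IsLeadingOddLevelAtTwo` copy dropped by -imc, R200b;
-imc's own farm rc 0·0·0·0 pre-p719493, BC7 `Probe59/59c/59d` 5/5 CLEAN; blocks `add59.txt` efdb7eb9e106ef06 + `add59b.txt` 6c69420b92a0ef76) and REF1's `HOME/REF1-data/b200/lean/Probe200.lean`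
**5c156619a4c6c199** (= Sketch59 541377e8 VERBATIM + 5 probes + 27 sorry-free REF1 decls incl. the three kernel refutations `P59B_false` / `P59W_false` / `P59D_false`; farm rc 0 · exactly 5 sorries).
Appended below the layer-four block: carriers `cubicGAtTwo`, `dupNumAtTwo` VERBATIM; **P59E `TwistPointBelowTieExistsAtTwo`** VERBATIM (plain def, THEOREM-GRADE support); **P59F
`TowerTwistBlindConductorSetAtTwo`** VERBATIM (`@[conjecture]`, CONJECTURE-CANDIDATE «the type-blind twisting conductors are exactly `f ∈ {2, 6, 8, 14, 20, 26}`», sharpening P58V);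
**P59B `TwistPointValuationBoundAtTwo`, P59W `TwistPointValuationWindowAtTwo`, P59D `PointDoublingValuationAtTwo` in REF1's REPAIRED FORMS C′ ONLY (R200a MANDATORY: one binder each —
the uniformiser binder `(Algebra.norm ℚ_[2] c).valuation = 1` replacing the iterate-root binder in P59B/P59W, `Odd lam →` in P59W, `X ≠ 0 →` in P59D; the sketched bodies are refuted in
the kernel and would have entered the tree as false support rows; the repaired forms are THEOREM-GRADE, REF1 proved them on paper — applied by the typer as for R193a/R194a, -imc's
names and docstrings kept verbatim + a rider stating the repair)**; -imc's five `decide` bookkeeping lemmas (`tie_levels_layer4/5`, `tie_iff_three_dvd_t`, `blindSet_matches_layers_2_to_5`,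
`doubledLevels_layer4`) and REF1's carrier / truncation certificates go to `TowerKummerAtlasAtTwoKernel.lean` (v4).  At the same touch (R4 of add3, REF2 v53 §15.2): P58U's docstring
gains «TWO ENGINES on 7 curves (k58 ‖ k59: 149/149 full planes identical + 55 nested, 0 inconsistent; add2/add3)», P58V's «survived its cheapest falsifier `f = 32` at layer 5
(S, 8/8 + 6/6 fresh classes); `V(f)` one function on 37 (layer, f) cells, 0 clash; the `f mod 6` reading is DEAD; sharpened by P59F».
GRADES (REF1-AUDIT §200 D-imc-58-R1 5/5, evidence `HOME/REF1-data/b200/` SHA16.txt): carriers CLEAN; **P59E SURVIVES theorem-grade; P59F SURVIVES conjecture-candidate; P59B/P59W/P59D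
KILLED AS TYPED (mis-stated), filed here ONLY as the repaired C′ (theorem-grade)**; port check p719493 CLEAN.  BC5: engine 3 `atlas5/k59.gp` (layers 3–5: kit j331209/j331384/j331383/j331499/
j331548/j331646, ≈ 9.2·10⁵ samples, ≈ 7.4·10⁵ points, 0 Hensel failures, 0 re-keying mismatches), layer 4 two-engine vs k58 (149/149 + 55 nested), layer 5 on six curves 158/158; thin
cells listed in P59F's rider (R200c).  REF2-PLACEMENT v54 (28acaeae8cf1e6a2) §1.3: P59F / V(f) NOT IN PRINT and OPEN IN PRINT (the `p = 2`, good-supersingular instance of Mazur–Rubin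
2015's open companion problem; Abhishek–Jha–Shekhar 2025 Rem. 4); §1.4: tie dictionary = restatement of v53 §7.2 = Kodaira trichotomy; §2: the Kodaira–Tamagawa ledger of the twists is
print-assembly (Wang 2024 Thm 1.2 + KT82 Thm 7.6 + one Tamagawa value `c = 2` on I₀*), type-and-sign-free ⟹ no classical invariant separates the types; §3: sign-blindness ∀n =
COROLLARY OF PRINT; §9: O-59m / flag profile = corollaries of Hazewinkel 1974 (to be typed as theorem-candidates when sketched).  LIVE FALSIFIER: layer-6 probe kit j331619.  Beyond-print
theorem: no.  PARTITION none.  BSD is not proved.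

## -imc's module docstring of `Sketch57.lean` (verbatim; its layer-two «CONJECTURE-CANDIDATE» paragraph = the killed P55t, see NEGATIVE RECORDS above)

# Cell `bsd-f1-sign2` (`p = 2`, non-CM), lens `-imc`, generation 19 — D-imc-55 sketch:
# THE KUMMER ATLAS UP THE CYCLOTOMIC ℤ₂-TOWER — THE KOBAYASHI/SPRUNG SIGN LIVES AT LAYER ONE ONLY

STATEMENTS ONLY (planner sketch; nothing asserted, nothing booked; PARTITION none; BSD not proved).

SETTING (as D-imc-54).  `E/ℚ₂` good supersingular (`a₂ ∈ {0, ±2}`); `F = ℚ₂(θ)`, `θ³ = 2`, is the root field of the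
`2`-division cubic for EVERY such `E`, so for any finite `K/ℚ₂` with `ζ₃ ∉ K` the space `H¹(K, E[2]) = V_K :=
ker(N : F_K^×/□ → K^×/□)`, `F_K = K(θ)`, is ONE space for all such `E` (`Aut(F_K/K) = 1`: the identification is canonical),
and for `δ ∈ K^×` the twisted local condition `Π_δ(E) := im(E^{(δ)}(K)/2) ⊂ V_K` is a maximal isotropic subspace
(`dim V_K = 2[K:ℚ₂]`, `dim Π = [K:ℚ₂]`; the Kummer class of a point `(x′, y′)` of a model `W′` of `E^{(δ)}` is `4x′ − θ′ =
δ(X − θ)`, the tree's `KummerField.kummerElt`).  THE ATLAS of `E` over `K` is the map `δ ↦ Π_δ(E)` on `K^×/K^{×2}`.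

LAYER ONE (`K ∈ {ℚ₂(√2) = ℚ_{2,1}, ℚ₂(i), ℚ₂(√−2)}`, 16 classes `δ` each; census kit j329487 = 8 558 curves (3 072 local
models `y²+y=x³+Ax+B`, `(A,B) mod 32` with lifts, + 5 486 Cremona good-ss `N < 10⁴`) × 3 fields × 16 classes = 410 784
saturated planes, 0 unsaturated, ENGINE 2′ `k55.gp` df72f301cfcddedc; second engine 1c `atlas55.py` (pure-python Eisenstein
rings) j329540):  with `U_K` = units, `W_K` = image of `{u ≡ 1 mod 2𝒪_K}` in `U_K/U_K²` (index 2), `u_K = 1+√2 | i | 1+√−2`: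
 (U1) `v_K(δ)` ODD (8 classes)  ⟹ `Π_δ(E) = P_odd(K)`, ONE plane independent of `E`        [8 558 × 8 × 3, 0 exceptions];
 (U2) `δ ∈ W_K` (4 classes)     ⟹ `Π_δ(E) = P_W(K)`, independent of `E` (`P_W(ℚ₂(√2)) = res H¹(ℚ₂,E[2])`) [0 exceptions];
 (D)  `δ ∈ u_K W_K` (4 classes) ⟹ `Π_{5δ}(E) = Π_δ(E)` and `Π_δ(E)` is determined by `a₂(E) mod 4`, the two values
      (`a₂ = 0` / `a₂ = ±2`) being DIFFERENT planes [4 480 vs 2 080 + 1 998 curves; `a₂ = +2` ≡ `a₂ = −2`; no finer invariant].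
So in conductor-exponent terms (`f(χ_δ) ∈ {0,2}` on `W_K`, `4` on `u_K W_K`, `5` on odd classes) the dependence on the
supersingular TYPE is NOT monotone in depth: the maximally ramified twists are type-blind again.  IMC READING: the generator
`δ₂ = 2 + √2` of the next layer `ℚ_{2,2} = ℚ_{2,1}(√δ₂)` is a uniformiser, hence (U1) type-blind; over `ℚ₂` itself the
generator `δ₁ = 2` is the ONE place where the type is visible (THM C of D-imc-54: `ℓ₁` for `a₂ = 0`, `ℓ₂` for `a₂ = ±2`).
CONJECTURE-CANDIDATE (layer two, engine k56.gp running): `Π_{δ₃}(E) ⊂ H¹(ℚ_{2,2}, E[2])`, `δ₃ = 2 + √(2+√2)`, is ONE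
maximal isotropic subspace for all `E` — «all Kobayashi/Sprung dependence of the twisted local conditions in the cyclotomic
ℤ₂-tower of ℚ₂ is concentrated at layer 1».
GLOBAL (A): TOWER COMPANION LAW — congruent supersingular companions have the same `dim Sel₂` at every layer `ℚ_n`, `n ≤ 3`
(two engines: bsd-2adic `sel2tower.gp` ‖ `engineB.py`; 268 pairs; first harvest 160 pairs × 4 layers 0/640 violations).
Sources: Kramer 1981 (Trans. AMS 264) Props. 1, 2, 4, Thm. 1; Mazur–Rubin 2007 (Ann. Math. 166) §2–3 (local conditions
of twists as Lagrangians; `H¹_f(E^χ) ∩ H¹_f(E) = im N E(L_w)`); Klagsbrun–Mazur–Rubin 2013 §3 (metabolic structure at `v ∣ 2`);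
Česnavičius 2016 (flat local conditions); the tree's `KummerField*.lean` (Kummer map over any field, homomorphism + Cassels
lemma PROVED), `SupersingularTowerNormIndexAtTwo.lean` (`selmerLayer`, `nRankAtLeast`), D-imc-54 `Sketch54.lean`.
-/

noncomputable section

open scoped Classical

open WeierstrassCurve Polynomial Literature.NumberTheory.EllipticCurves
  Literature.NumberTheory.EllipticCurves.Rank1Residual ZpExtension
open Literature.Barriers.BirchSwinnertonDyer (nRankAtLeast)
open Summit.BirchSwinnertonDyer.Rank1Residual.F1Sign2.KummerField (algK rootK kummerElt cubicK)

namespace Summit.BirchSwinnertonDyer.Rank1Residual.F1Sign2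

/-- Membership of `α` in the PLANE `{1, p, q, pq}` of `L^×/L^{×2}` spanned by the classes of `p` and `q`. [folklore]
REF1-AUDIT §190 BC7: faithful — «`α ∈ ⟨p, q⟩ mod □`» (`α = 0` would pass via `IsSquare 0`, but `kummerElt` is never `0` on `K`-points: `θ′ ∉ K`). -/
def InKummerPlaneOver {L : Type*} [CommRing L] (p q α : L) : Prop :=
  IsSquare α ∨ IsSquare (α * p) ∨ IsSquare (α * q) ∨ IsSquare (α * p * q)

/-- «The Kummer image of `W′(K)` (classes of `kummerElt W′ P = 4x(P) − θ′`) is EXACTLY the plane `{1, p, q, pq}`»: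
every point lands in the plane, and the classes of `p` and of `q` are attained.  (For `K/ℚ₂` quadratic and `W′(K)[2] = 0`
the image has order `4`, so «contained + both generators hit» = «equal».) [folklore]
REF1-AUDIT §190 BC7: faithful — «image ⊆ ⟨p, q⟩ ∧ p, q ∈ image» = «image = the plane» given `#E′(K₁)/2 = 4` (no `K₁`-rational 2-torsion); if `p ~ q` or
`p ∈ □` the `∀`-clause is FALSE, not vacuous. -/
def KummerImageIsPlaneOver {K : Type*} [Field K] (W' : WeierstrassCurve K) (p q : algK W') : Prop :=
  (∀ P : W'.toAffine.Point, InKummerPlaneOver p q (kummerElt W' P)) ∧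
    (∃ P : W'.toAffine.Point, IsSquare (kummerElt W' P * p)) ∧ (∃ P : W'.toAffine.Point, IsSquare (kummerElt W' P * q))

/-- **P55u1 `LayerOneOddTwistKummerPlaneAtTwo` (law U1 at the IMC-relevant classes; theorem-candidate by two-engine census,
8 558 curves × {√2, 2+√2, and the 6 other odd classes}, 0 exceptions; hand proof NOT yet written).**  `W/ℚ` good supersingular
at `2`; `K ≅ ℚ₂(√2)` (a quadratic `ℚ₂`-algebra field with `s² = 2`) = the first layer `ℚ_{2,1}` of the cyclotomic `ℤ₂`-tower
of `ℚ₂`; `δ = s` (a uniformiser) or `δ = 2 + s` (THE GENERATOR OF LAYER TWO: `ℚ_{2,2} = K(√(2+√2))`); `W′` any model over `K`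
of the twist `W^{(δ)}`; `t` the cube root of `2` in `L_{W′} = K[T]/(c_{W′}) ≅ K(∛2)`.  Then the Kummer image of `W′(K)` is the
plane `P_odd = {1, [1 + 2t], [−1 − s t + t²], [−1 − s t − t²]}` — the SAME plane for every such `W`, whatever `a₂(W) ∈ {0, ±2}`:
the layer-two local condition is blind to the Kobayashi (`a₂ = 0`) / Sprung (`a₂ = ±2`) type.
Why it might fail: a slip in the frame identification of the census (the plane is read off `ideallog` parities / canonical
unit representatives modulo `𝔭^13 ⊂` squares), or a curve outside the local-constancy modulus actually probed (`(A,B) mod 32`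
+ lifts mod `2^17` + Cremona) — i.e. the law holding mod 32 but not 2-adically (excluded if the Kummer plane is locally constant
in `(A,B)` with modulus `≤ 32`, which the lift census supports 2 048/2 048 but does not prove).
Cheapest falsifier: ONE good-ss `W` and one `K`-point of `W^{(2+√2)}` whose class is outside `P_odd`.
[cite: Kramer1981, Prop. 4] [cite: MazurRubin2007, §2]
REF1-AUDIT §190: **SURVIVES** (data-law; REF1 third independent engine `eng190a.py` in the power basis of `ℚ₂(2^{1/6}) = K₁(∛2)`: all 8 odd classes give
`P_odd = {1, ℓ₀, n, n′}` on 18/18 curves; the «∀ s» form is consistent under `σ : s ↦ −s` because `σ(n) = n′` and `n·n′ = ℓ₀ mod □`).  REF2-PLACEMENT v53 §4/§7.1: NOT IN PRINT as a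
Kummer-image statement (corpus + galaxy nulls for twisted Kummer images over ramified `ℚ_{2,n}`); print nearby = the norm-index frame [cite: Kramer1981, Prop. 4, Prop. 7] (N55:
`i(K₁(√δ)/K₁; E) = 1` on the odd classes) and the Kodaira types / conductor exponents of the twists [cite: WangHaiyang2024, Thm. 1.2] — print facts, but NOT the signed object
(the (F3) s-dictionary was retracted, v53 §7.1 TRAP T53-3). -/
def LayerOneOddTwistKummerPlaneAtTwo : Prop :=
  ∀ (W : WeierstrassCurve ℚ) [W.IsElliptic] [W.IsGloballyMinimal], GoodSS W 2 →
  ∀ (K : Type) [Field K] [CharZero K] [Algebra ℚ_[2] K], Module.finrank ℚ_[2] K = 2 →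
  ∀ s : K, s ^ 2 = 2 →
  ∀ δ : K, (δ = s ∨ δ = 2 + s) →
  ∀ (W' : WeierstrassCurve K) [W'.IsElliptic], (∃ C : VariableChange K, C • (W.baseChange K).quadraticTwist δ = W') →
  ∀ t : algK W', t ^ 3 = 2 →
    KummerImageIsPlaneOver W' (1 + 2 * t) (-1 - algebraMap K (algK W') s * t + t ^ 2)

/-- **P55u2 `LayerOneKummerPlaneIsRestrictionAtTwo` (law U2 at `δ = 1`; theorem-candidate by two-engine census 8 558/8 558,
= D-imc-54 ENGINE 2 `plane1` and ENGINE 1/1b layer-1 planes 5 486/5 486; hand proof NOT yet written).**  Over `K ≅ ℚ₂(√2)` the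
UNTWISTED Kummer image of `W(K)` is the plane `P_W = {1, [1 + 2t], [t − 1], [(1 + 2t)(t − 1)]} = res_{K/ℚ₂} H¹(ℚ₂, W[2])`
— the whole local cohomology of the base, restricted — for every good supersingular `W`.  (This is the layer-1 flatness
input of the tower companion law P55a below.)  Why it might fail: as P55u1.  Cheapest falsifier: one `W` and one `K`-point
with class outside `P_W`. [cite: Kramer1981, Prop. 4] [cite: Cesnavicius2016SelmerFlat, Prop. 2.5]
REF1-AUDIT §190: **SURVIVES** (data-law; REF1 third engine: `res ℤ₂^× ↦ ⟨ℓ₀, ℓ₁⟩`, 18/18 curves; N55 `i = 0` on `res ℤ₂^×`).  REF2-PLACEMENT v52 §3.2 / v53 §4: the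
layer-1 flatness input of P55a; frame in print ([cite: Kramer1981, Prop. 4, Prop. 7]; flat local conditions [cite: Cesnavicius2016SelmerFlat, Prop. 2.5] — typer key
normalisation of -imc's `Cesnavicius2016`); the explicit plane is NOT IN PRINT. -/
def LayerOneKummerPlaneIsRestrictionAtTwo : Prop :=
  ∀ (W : WeierstrassCurve ℚ) [W.IsElliptic] [W.IsGloballyMinimal], GoodSS W 2 →
  ∀ (K : Type) [Field K] [CharZero K] [Algebra ℚ_[2] K], Module.finrank ℚ_[2] K = 2 →
  ∀ s : K, s ^ 2 = 2 →
  ∀ (W' : WeierstrassCurve K) [W'.IsElliptic], (∃ C : VariableChange K, C • W.baseChange K = W') →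
  ∀ t : algK W', t ^ 3 = 2 →
    KummerImageIsPlaneOver W' (1 + 2 * t) (t - 1)

/-- **P55d `LayerOneUnitTwistKummerPlaneDichotomyAtTwo` (law D — THE SIGNED OBJECT AT LAYER ONE; theorem-candidate by
two-engine census: `a₂ = 0`: 4 480 curves ↦ `P2`, `a₂ = ±2`: 4 078 curves ↦ `P4`, 0 exceptions; hand proof NOT yet written).**
Over `K ≅ ℚ₂(√2)`, for the UNIT `δ = 1 + s` (the fundamental unit; `δ ∉ W_K`, conductor exponent `f(χ_δ) = 4`) the Kummer
image of `W^{(δ)}(K)` is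
 `P2 = {1, n, m₂, n m₂}`,  `n = [−1 − s t + t²]`,  `m₂ = [−s + (1 − s)t − s t²]`         if `a₂(W) = 0`  (Kobayashi type),
 `P4 = {1, n′, m₄, n′ m₄}`, `n′ = [−1 − s t − t²]`, `m₄ = [−s + (−1 + s)t + s t²]`      if `a₂(W) = ±2` (Sprung type),
and `P2 ≠ P4`.  With THM C of D-imc-54 (`δ₁ = 2` over `ℚ₂`) this is the complete list of places in the atlas of the first
two tower fields where the supersingular type is visible mod 2.  Why it might fail: as P55u1; also the `±s` convention
(the statement for `−s` is the Galois conjugate statement for the twist by `1 − s`, equivalent by transport).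
Cheapest falsifier: one `a₂ = 0` curve whose `(1+√2)`-twist has a `K`-point of class `m₄`.
[cite: Kramer1981, Prop. 4] [cite: MazurRubin2007, §3]
REF1-AUDIT §190: **SURVIVES** (data-law; REF1 third engine: `δ = 1 + s`: `a₂ = 0 ↦ ⟨n, m₂⟩ = {00, 03, 04, 07}`, `a₂ = ±2 ↦ ⟨n′, m₄⟩ = {00, 0b, 24, 2f}`,
`P2 ∩ P4 = 0`; `δ = 1 − s` gives the `σ`-conjugate planes — consistent with «∀ s»; `frobeniusTrace 2 = 0 ↔ a₂ = 0` ✓).  REF2-PLACEMENT v52 §1 / v53 §4: THE SIGNED OBJECT AT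
LAYER ONE is NOT IN PRINT as a statement; its `a₂`-dependence is Honda print (`Ê/ℤ₂` determined by `a₂ ∈ {0, ±2}`: [cite: Honda1970, Thm. 9], Hill 1971 (bib `Hill1971`); packaged
[cite: Kobayashi2003, Thm. 8.3, Thm. 8.4]); the class `(1+√2)·W_K` = the I₀*-coset `s = 3` of [cite: WangHaiyang2024, Thm. 1.2] (a print fact about the twist, not a law:
v53 §7.1). -/
def LayerOneUnitTwistKummerPlaneDichotomyAtTwo : Prop :=
  ∀ (W : WeierstrassCurve ℚ) [W.IsElliptic] [W.IsGloballyMinimal], GoodSS W 2 →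
  ∀ (K : Type) [Field K] [CharZero K] [Algebra ℚ_[2] K], Module.finrank ℚ_[2] K = 2 →
  ∀ s : K, s ^ 2 = 2 →
  ∀ (W' : WeierstrassCurve K) [W'.IsElliptic], (∃ C : VariableChange K, C • (W.baseChange K).quadraticTwist (1 + s) = W') →
  ∀ t : algK W', t ^ 3 = 2 →
    (W.frobeniusTrace 2 = 0 →
      KummerImageIsPlaneOver W' (-1 - algebraMap K (algK W') s * t + t ^ 2)
        (-algebraMap K (algK W') s + (1 - algebraMap K (algK W') s) * t - algebraMap K (algK W') s * t ^ 2)) ∧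
    (W.frobeniusTrace 2 ≠ 0 →
      KummerImageIsPlaneOver W' (-1 - algebraMap K (algK W') s * t - t ^ 2)
        (-algebraMap K (algK W') s + (-1 + algebraMap K (algK W') s) * t + algebraMap K (algK W') s * t ^ 2))

-- `AreSupersingularCompanionsAtTwo` is the tree's (F1Sign2/SupersingularKummerAtlasAtTwo.lean, p713130; text identical to D-imc-54's).

/-- **P55a `TowerCompanionTwoSelmerRankLawAtTwo` (GLOBAL TOWER COMPANION LAW; theorem-candidate: layer 0 = THM A of D-imc-54 +
Poitou–Tate sandwich; layers 1–3 = layer-wise flatness of the untwisted supersingular local condition (layer 1 = P55u2, two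
engines; layer 2 = k56 pending) + Mazur–Rubin silent primes (Tamagawa-odd persists up the unramified-at-ℓ tower: `v_w(Δ) =
v_ℓ(Δ)` odd) + all real places; census kit j329358 ‖ j329359: 268 companion pairs (`N < 10⁴`, Δ < 0), layers `n ≤ 3` /
`n ≤ 2`, first harvest 160 pairs × 4 layers = 640 comparisons, 0 violations, A = B 384/384).**  For supersingular companions
`W, W'` and the cyclotomic `ℤ₂`-extension `κ` of `ℚ`, at every layer `ℚ_N`, `N ≤ 3`: `rk₂ Sel_{2^∞}(W/ℚ_N) = rk₂ Sel_{2^∞}(W'/ℚ_N)`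
(`= dim Sel₂`, as `W(ℚ_N)[2] = 0`) — the Kobayashi/Sprung divide (rank-0 growth `0,1,1,3` for `a₂ = ±2` vs `0,1,1,5` for
`a₂ = 0`, KO 2006 / D-imc-16) is invisible INSIDE a companion pair: MIXED pairs never contain a `Sel₂ = 0` curve (P54g).
Why it might fail: a pair whose local conditions at the layer-`N` prime above `2` differ although `W[2] ≅ W'[2]` — exactly a
failure of layer-`N` flatness (P55u2-type) for `N = 2, 3`, where only the global census and (for `N = 2`) k56 speak.
Cheapest falsifier: one pair with `s₂(W/ℚ_N) ≠ s₂(W'/ℚ_N)`, both engines agreeing.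
[cite: Kramer1981, Thm. 1] [cite: MazurRubin2010, Lemma 2.10] [cite: Cesnavicius2016SelmerFlat, Prop. 2.5]
REF1-AUDIT §190: **SURVIVES as typed** (`N ≤ 3` = the data range, honest; two engines j329358 ‖ j329359, 268 pairs, 1 072 checks, 0 violations).  REF2-PLACEMENT v52 §3.2 /
v53 §4 (F1): REGRESSION OF PRINT — companions share the 2-Selmer structure layer by layer by Česnavičius (B∞) + [cite: MazurRubin2010, Lemma 2.10] (silent primes) given
layer-wise flatness (P55u2 at `n = 1`); the growth vector `(0,1,1,3)` for `a₂ = ±2` with `ord₂(L(E,1)/Ω_E) = ord₂(Tam E) = 0` IS IN PRINT [cite: KuriharaOtsuki2006, Thm. 0.1,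
Prop. 1.1, Cor. 1.2, Prop. 1.4] (`s₂(E/ℚ_n) = q_n`; pre-registered `s₂(ℚ₄) = 5`), the `a₂ = 0` vector `(0,1,1,5)` is not (KO Rem. 0.2(3)); typer key normalisation
`Cesnavicius2016` → [cite: Cesnavicius2016SelmerFlat, Prop. 2.5]. -/
def TowerCompanionTwoSelmerRankLawAtTwo : Prop :=
  ∀ (W W' : WeierstrassCurve ℚ) [W.IsElliptic] [W'.IsElliptic] [W.IsGloballyMinimal] [W'.IsGloballyMinimal],
    AreSupersingularCompanionsAtTwo W W' →
  ∀ (κ : ZpExtension ℚ 2), κ.IsCyclotomic → ∀ N : ℕ, N ≤ 3 → ∀ k : ℕ,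
    (nRankAtLeast (↥(W.selmerLayer κ N)) 2 k ↔ nRankAtLeast (↥(W'.selmerLayer κ N)) 2 k)

/-! ## D-imc-55 (B2): the layer-`n` fields and the TYPE LAW -/

/-- `K` is (a model of) the `n`-th layer `ℚ_{2,n} = ℚ₂(ζ_{2^{n+2}})⁺` of the cyclotomic `ℤ₂`-extension of `ℚ₂`:
`[K : ℚ₂] = 2ⁿ` and `K` contains `c = 2cos(π/2^{n+1})`, i.e. a root of the `n`-fold iterate of `x ↦ x² − 2`
(`n = 1`: `c = √2`; `n = 2`: `c = √(2+√2)`; the degree condition forces `K = ℚ₂(c)`).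
REF1-AUDIT §190 BC7: pins `K ≅ ℚ_{2,n}` — the `n`-fold iterate of `x² − 2` is Eisenstein for `n ≥ 1` (`≡ x^{2ⁿ} mod 2`, constant term `∓2`), so any root `c` has
`[ℚ₂(c) : ℚ₂] = 2ⁿ = finrank` ⟹ `K = ℚ₂(c)`; `n = 0`: `id c = 0` has the witness `0`, so the def `↔ finrank = 1` (kernel lemma `layer_zero_iff`). -/
def IsCyclotomicLayerAtTwo (n : ℕ) (K : Type) [Field K] [Algebra ℚ_[2] K] : Prop :=
  Module.finrank ℚ_[2] K = 2 ^ n ∧ ∃ c : K, (fun x : K => x ^ 2 - 2)^[n] c = 0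

/-- The Kummer images of `W₁′(K)` and `W₂′(K)` AGREE: along any `K`-algebra map of the cubic algebras (for good
supersingular curves both are the field `K(∛2)` with trivial automorphism group, so the map is the unique isomorphism)
every Kummer class of `W₁′` is matched by a Kummer class of `W₂′` (product a square).
REF1-AUDIT §190 (iv) / §190-add (2): the INCLUSION `φ(Π₁) ⊆ Π₂` per `K`-algebra map `φ`; used symmetrically with `#Π₁ = #Π₂ = 2^{2ⁿ}`, so the laws say «equal» ✓;
keep this form — do NOT add a `Nonempty (algK W₁′ ≃ₐ[K] algK W₂′)` hypothesis (it could only weaken).  It is vacuously true for a pair admitting NO `K`-algebra map, hence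
every NEGATED use (P56U's sensitive side, P57U's `←`, P57O) ENTAILS `Nonempty (algK W₁′ →ₐ[K] algK W₂′)`: the tower form of P54t `SupersingularCubeRootOfTwoAtTwo`
(`algK W′ ≅ K_n(∛2)` for every good-supersingular twist: `3 ∤ 2ⁿ`, `ζ₃ ∉ K_n`, `φ` unique) is LOAD-BEARING for a prover of any sensitivity statement (true; not yet a tree
theorem over `K_n`).  Kernel lemma `kummerImagesAgree_refl` (reflexive along `AlgHom.id`). -/
def KummerImagesAgree {K : Type} [Field K] (W₁' W₂' : WeierstrassCurve K) : Prop :=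
  ∀ φ : algK W₁' →ₐ[K] algK W₂',
    ∀ P₁ : W₁'.toAffine.Point, ∃ P₂ : W₂'.toAffine.Point, IsSquare (φ (kummerElt W₁' P₁) * kummerElt W₂' P₂)

/-- **P56T `TowerKummerTypeLawAtTwo n` (DATA-LAW for `n ≤ 2`, CONJECTURE-CANDIDATE for all `n`; «the twisted Kummer atlas of
layer `n` is a function of `a₂ mod 4`»).**  For good supersingular `W₁, W₂ /ℚ` of the SAME TYPE (`a₂(W₁) ≡ a₂(W₂) mod 4`,
i.e. both Kobayashi-type `a₂ = 0` or both Sprung-type `a₂ = ±2`), every layer field `K = ℚ_{2,n}` and every twist class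
`δ ∈ K^×`, the Kummer images of `W₁^{(δ)}(K)` and `W₂^{(δ)}(K)` in `K(∛2)^×/□` agree.  Census: `n = 0` THM A–C of D-imc-54
(all 8 classes); `n = 1` laws U1/U2/D (two engines, 25 674 rows, 0 exceptions); `n = 2` engine 2″ j329775: 8 558 curves ×
64 classes, exactly one plane per (`δ`, type), 0 exceptions, 1 024/1 024 local-model lift groups consistent.
Why it might fail: at some layer the plane could read `a₂ mod 8`, the sign of `a₂`, or deeper digits of the curve (the first
python engine's — unsound, since corrected — output looked exactly like that); nothing in print fixes the depth.
Cheapest falsifier: one pair of same-type curves and one `δ` at layer 3 with different planes (engine 2″ generalises).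
[cite: Kramer1981, Prop. 4] [cite: MazurRubin2007, §3] [cite: Kobayashi2003]
REF1-AUDIT §190 / §190-add: **SURVIVES**; `n ≤ 2` data with THREE engines (n = 1: k55.gp ‖ atlas55.py ‖ REF1 eng190a; n = 2: k56b.gp ‖ atlas56.py 547 712/0 ‖ REF1
eng190b 18 336/18 336), `n = 3` TWO engines (-imc §10.98-add4: GP `k57b.gp` j330462 vs `atlas57.py` j330261, planes agree 18 432/18 432, 0 disagree); **for `n ≤ 3` it
FOLLOWS FROM PRINT + a finite Tate census — NOT beyond print**: same `a₂` ⟹ `Ê₁ ≅ Ê₂` over `ℤ₂` ([cite: Honda1970, Thm. 9]; local form Hill 1971 (bib `Hill1971`)) transports every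
twisted Kummer image, and the hypothesis «`a₂ ≡ a₂′ (mod 4)`» = «same type up to the SIGN of `a₂`» is justified by «[5] ∈ C_n» ([cite: Kramer1981, Prop. 7] for `E^{(δ)}`,
`d = 5` + [cite: Mazur1972, Cor. 4.2] + REF1's Tate census `tate190.py` over `ℤ₂[c_n]`: all twist types ∈ {I₀, II, II*, I₀*(c = 2)} ⟹ `i(K_n(√5)/K_n; E^{(δ)}) = 0`,
confirmed 1 024/1 024 at `n = 3`); general `n`: conjecture-candidate.  REF2-PLACEMENT v52 §1 / v53 §4 (F4), §7.1: `a₂`-dependence = Honda PRINT; sign-half COROLLARY OF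
PRINT at `n = 0` without cells and wherever the twist has Kodaira type II/II*, one Tamagawa check on the I₀*-cosets; the statement «one atlas per type per layer» is NOT IN
PRINT as a sentence.  **FOLD (REF2-PLACEMENT v54 §3.1 CLAIM S ∘ REF1-AUDIT §204 R-S PASS, 2026-08-29): the SIGN clause («same type up to the SIGN of `a₂`», i.e.
`Π_{5δ} = Π_δ` in `H¹(K_n, E[2])` for every layer `n` and every `δ`) is a COROLLARY OF PRINT FOR ALL `n`** — [cite: WangHaiyang2024, Thm. 1.2] gives the Kodaira types
II / I₀* / II* of every ramified twist over every totally ramified `K/ℚ₂` (`s = f(χ_δ) − 1`, `v_K(j) ≥ 12e_K`), `K_n(√5) = K_n(ζ₃)` is THE unramified quadratic extension,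
[cite: Kramer1981, Prop. 7] + [cite: KramerTunnell1982, §6] + [cite: Mazur1972, Cor. 4.2] reduce `i_unr` to `Ĥ⁰(C₂, Φ(𝔽₄)[2^∞])`, and the Tamagawa check is VACUOUS over
the residue field `𝔽₂` (a separable cubic over `𝔽₂` has `≤ 1` root ⟹ `c(I₀*) ∈ {1, 2}` ⟹ Frobenius a 3-cycle or a transposition on the far components ⟹ `Ĥ⁰ = 0`) ⟹
`i_unr = 0` ⟹ `Π_{5δ} = Π_δ` ∀`n` (with [cite: Honda1970, Thm. 9] for the `a₂ ↦ −a₂` transport); the `n ≤ 3` census is a check of Wang's theorem.  The TYPE clause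
(`a₂ mod 4`-dependence beyond the sign) is UNCHANGED: conjecture-candidate beyond the censused layers (REF2 v54 §2.4: it follows for all `n` from nothing in print). -/
def TowerKummerTypeLawAtTwo (n : ℕ) : Prop :=
  ∀ (W₁ W₂ : WeierstrassCurve ℚ) [W₁.IsElliptic] [W₂.IsElliptic] [W₁.IsGloballyMinimal] [W₂.IsGloballyMinimal],
    GoodSS W₁ 2 → GoodSS W₂ 2 → (W₁.frobeniusTrace 2 : ZMod 4) = (W₂.frobeniusTrace 2 : ZMod 4) →
  ∀ (K : Type) [Field K] [CharZero K] [Algebra ℚ_[2] K], IsCyclotomicLayerAtTwo n K →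
  ∀ δ : K, δ ≠ 0 →
  ∀ (W₁' W₂' : WeierstrassCurve K) [W₁'.IsElliptic] [W₂'.IsElliptic],
    (∃ C : VariableChange K, C • (W₁.baseChange K).quadraticTwist δ = W₁') →
    (∃ C : VariableChange K, C • (W₂.baseChange K).quadraticTwist δ = W₂') →
    KummerImagesAgree W₁' W₂'

/-- `δ ∈ K^×` has ODD valuation (`K/ℚ₂` totally ramified, so `v_K(δ) = v₂(N_{K/ℚ₂} δ)`).
REF1-AUDIT §190 BC7: ✓ — `v_K(δ) = v₂(N_{K/ℚ₂} δ)` because `K_n/ℚ₂` is totally ramified; the `δ ≠ 0` guard is explicit (kernel lemma `not_isOddClass_zero`). -/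
def IsOddClassAtTwo {K : Type} [Field K] [Algebra ℚ_[2] K] (δ : K) : Prop :=
  δ ≠ 0 ∧ Odd ((Algebra.norm ℚ_[2] δ).valuation)

/-- **P56U `LayerTwoTypeBlindUnitClassesAtTwo` (DATA-LAW, engine 2″ j329775; «at layer two exactly 28 of the 64 classes are
type-blind: the unit classes outside the coset (1+c⁵)·{±1, ±5}·K^{×2}`, `c = √(2+√2)`»).**  For a UNIT class `δ`
(even valuation) of `K = ℚ_{2,2}` not of the form `(1 + c⁵)·q·x²` with `q ∈ {1, −1, 5, −5}`, the Kummer images of the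
`δ`-twists of ANY two good supersingular curves agree (28 classes; the complementary 4 unit classes and all 32 odd classes
separate the two types, P56S).  At layer one the analogous blind set is «odd, or ≡ □ mod 4» (12 of 16 classes, laws U1/U2).
Why it might fail: the description of the 4 exceptional unit classes as `(1+c⁵)·⟨−1,5⟩` is read off one engine's class
dictionary (531 named classes); a mis-named coset would misplace the exceptional quarter.  Cheapest falsifier: one curve pair
and one of the 28 classes with distinct planes (python engine 1d full run = the second engine, pending at typing time).
[cite: Kramer1981, Prop. 4]
REF1-AUDIT §190: **SURVIVES** (data-law; REF1 third engine at `n = 2`: 9 curves × 64 classes, 192 cells, 18 336/18 336 same-plane pairs agree with -imc's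
`SUMMARY-56-py`, 22 = 22 planes; norm indices `i = 0 / 2 / 3` on `res⟨−1,5⟩` / the 28 other unit classes / the 32 odd classes, both types).  NOTE (REF1 §190-add (2)): the
SENSITIVE side («the complementary 4 unit classes and all 32 odd classes separate the two types») is a NEGATED `KummerImagesAgree` and uses `algK W′ ≅ K(∛2)`
(P54t-tower, see `KummerImagesAgree`).  REF2-PLACEMENT v53 §4/§7.1: NOT IN PRINT; the coset `(1+c⁵)·⟨−1,5⟩` = the classes of leading level exactly 5 = the I₀*-twists
`s = 3` of [cite: WangHaiyang2024, Thm. 1.2] at this layer — a print FACT about the twists, but the s/Kodaira reading of blindness is DEAD as a law (level 5 is sensitive again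
at `n = 3` where it is type II): state blind sets by LEVEL (P57U/P57L), not by type. -/
def LayerTwoTypeBlindUnitClassesAtTwo : Prop :=
  ∀ (W₁ W₂ : WeierstrassCurve ℚ) [W₁.IsElliptic] [W₂.IsElliptic] [W₁.IsGloballyMinimal] [W₂.IsGloballyMinimal],
    GoodSS W₁ 2 → GoodSS W₂ 2 →
  ∀ (K : Type) [Field K] [CharZero K] [Algebra ℚ_[2] K], Module.finrank ℚ_[2] K = 4 →
  ∀ c : K, (c ^ 2 - 2) ^ 2 = 2 →
  ∀ δ : K, δ ≠ 0 → Even ((Algebra.norm ℚ_[2] δ).valuation) →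
    (¬ ∃ q ∈ ({1, -1, 5, -5} : Finset K), ∃ x : K, δ = (1 + c ^ 5) * q * x ^ 2) →
  ∀ (W₁' W₂' : WeierstrassCurve K) [W₁'.IsElliptic] [W₂'.IsElliptic],
    (∃ C : VariableChange K, C • (W₁.baseChange K).quadraticTwist δ = W₁') →
    (∃ C : VariableChange K, C • (W₂.baseChange K).quadraticTwist δ = W₂') →
    KummerImagesAgree W₁' W₂'

/-! ## D-imc-56 — LAYER THREE (`K = ℚ_{2,3} = ℚ₂(2cos(π/16))`, `e = 8`, `1 024` classes, Kummer Lagrangians of dimension `8`)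

Engine 1e `atlas57.py` (pure python; `F = K(∛2) = ℚ₂(ϖ)`, `ϖ = c³θ²/2`, `ϖ³ = c⁹/2`, minimal polynomial
`M₂₄(X) = g₃(X³)`, `g₃(Y) = Y⁸ − 48584·Y⁶ + 109357172·Y⁴ − 182098768·Y² + 2` computed exactly — the same code returns layer two's
`w¹² − 3940w⁶ + 2`), kit job j330261: 18 non-CM Cremona curves (6 per `a₂ ∈ {0, 2, −2}`), every curve saturated (1 024/1 024 buckets of
rank 8), 0 errors.  Fold `FOLD-57-j330261.txt`: TYPE LAW 0 violations / 3 072 cells; sign of `a₂` visible on 0 / 1 024 classes;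
translation group `C₃ = {1, [5]}`; ALL 512 odd classes type-SENSITIVE (kills P56S at `n = 3`); unit classes: 356 sensitive / 156 blind,
decided by the LEADING LEVEL `ℓ(δ)` alone (truth table over the intrinsic bits `1+c^k`): `ℓ ∈ {1,5,7,13}` sensitive, `ℓ ∈ {3,9,11,15,16,∞}`
blind; `dim(P⁰ ∩ P^±) ∈ {4 (256 buckets), 6 (612 buckets)}`.  ONE ENGINE ONLY at layer three (the GP engine 2″ is not yet generalised). -/

/-- `δ ∈ U_K^{(k)}·K^{×2}`: `δ` is a nonzero square times a unit `≡ 1 (mod 𝔪_K^k)`, written with a uniformiser `c` of `K`;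
integrality of `y` is expressed through the norm (`K` is a field finite over `ℚ₂`, so `v_K(y) ≥ 0 ↔ v₂(N_{K/ℚ₂} y) ≥ 0`; `y = 0`
is allowed).  The LEADING LEVEL `ℓ(δ)` of an even class is the largest `k` with this property (`k` odd `< 2e`, or `2e`, or `∞`);
it is `2e + 1 − f(χ_δ)` for the conductor exponent `f` of `K(√δ)/K` when `ℓ < 2e`. [folklore] (Serre, Corps locaux XV §3)
REF1-AUDIT §190-add (1): faithful — «`δ ∈ K^{×2}·U^{(k)}`» for `k ≥ 1` when `c` is a uniformiser; `y = 0` passes because Mathlib's `Padic.valuation 0 = 0` (intended);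
`k = 0` is «everything» (harmless, unused); `U = U^{(1)}` (residue field `𝔽₂`) so every unit class has `ℓ ≥ 1`; the filtration `U^{(k)}K^{×2}` is uniformiser-independent, so
— unlike P56U's coset words — the level words do not depend on WHICH root `c` is taken.  (Typer: -imc's free-form folklore bracket normalised to the tag + parenthesis.)
REF1-AUDIT §192 (g18) JUNK EDGE — only meaningful under a finiteness binder (`FiniteDimensional ℚ_[2] K`, as the laws' `finrank` / `IsCyclotomicLayerAtTwo`
hypotheses force): if `K` has NO finite `ℚ₂`-basis, Mathlib's `Algebra.norm ℚ_[2]` is the junk constant `1`, the guard `0 ≤ v₂(N y)` becomes `0 ≤ 0`, and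
`InUnitFiltrationSqAtTwo c k δ` holds for EVERY `δ` and every `c ≠ 0` (`x = 1`, `y = (δ − 1)/cᵏ`) — PROVED, kernel lemma `inUnitFiltrationSq_of_no_basis`; also
`inUnitFiltrationSq_sq` (every nonzero square is in every level, witness `y = 0`) and `inUnitFiltrationSq_zero_iff` (`δ = 0` only via `1 + cᵏy = 0`; the laws carry `δ ≠ 0`). -/
def InUnitFiltrationSqAtTwo {K : Type} [Field K] [Algebra ℚ_[2] K] (c : K) (k : ℕ) (δ : K) : Prop :=
  ∃ x y : K, x ≠ 0 ∧ 0 ≤ (Algebra.norm ℚ_[2] y).valuation ∧ δ = x ^ 2 * (1 + c ^ k * y)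

/-- The layer-three BLIND LEVELS: `ℓ(δ) ∈ {3} ∪ {9, 11} ∪ {15, 16, ∞}` (156 of the 512 unit classes of `ℚ_{2,3}`; data j330261).
REF1-AUDIT §190-add (1): `= (In 3 ∧ ¬In 5) ∨ (In 9 ∧ ¬In 13) ∨ In 15` = «`ℓ ∈ {3} ∪ {9, 11} ∪ {15, 16, ∞}`» ✓ (even levels 4, 10, 12, 14 absorbed:
`U^{(2j)}K² = U^{(2j+1)}K²` for `2j < 16`) = -imc's blind table; complement among unit classes = `{1, 5, 7, 13}` ✓.  Kodaira dictionary of the level sets (REF1, for O-57u only):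
`ℓ = 1, 7, 13 ↦ I₀*`, `3, 9, 15 ↦ II*`, `5, 11 ↦ II`, `16 ↦ I₀`.  REF1 §192 BC7: the trivial class `δ = 1` and every
nonzero square class (level `∞`) are on the BLIND side (kernel `isTypeBlind_sq` / `isTypeBlind_one`) — consistent with the fold (`[1]`, `[5]` blind at every layer). -/
def IsTypeBlindLevelAtLayerThree {K : Type} [Field K] [Algebra ℚ_[2] K] (c δ : K) : Prop :=
  (InUnitFiltrationSqAtTwo c 3 δ ∧ ¬ InUnitFiltrationSqAtTwo c 5 δ) ∨
  (InUnitFiltrationSqAtTwo c 9 δ ∧ ¬ InUnitFiltrationSqAtTwo c 13 δ) ∨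
  InUnitFiltrationSqAtTwo c 15 δ

/-- **P57U `LayerThreeUnitTwistTypeLawAtTwo` (DATA-LAW, one engine: atlas57.py j330261, 18 curves × 512 unit classes, 0
exceptions; «at layer three the type-blind unit classes are exactly the classes of leading level `3, 9, 11` or `≥ 15`»).**
For good supersingular `W₁, W₂ /ℚ` of DIFFERENT type (`a₂ ≢ a₂'` mod 4), `K = ℚ_{2,3}` (`[K:ℚ₂] = 8`, `c = 2cos(π/16)`,
`c⁸ − 8c⁶ + 20c⁴ − 16c² + 2 = 0`) and a unit class `δ`, the Kummer images of `W₁^{(δ)}(K)` and `W₂^{(δ)}(K)` in `K(∛2)^×/□`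
agree iff `ℓ(δ) ∈ {3, 9, 11, 15, 16, ∞}`; they differ (with `dim(P⁰ ∩ P^±) ∈ {4, 6}`) iff `ℓ(δ) ∈ {1, 5, 7, 13}`.  Layer two in the
same words: blind iff `ℓ(δ) ≠ 5` (P56U: `(1+c⁵)·⟨−1,5⟩ = ` the classes of level exactly 5); layer one: blind iff `ℓ(δ) ≠ 1`.
Why it might fail: one engine only at layer three (no GP cross-check yet); 6 curves per type; the level sets are read through the
engine's own bit basis `1 + c^k` (intrinsic, but a descent bug at one level would shift a whole level set).
Cheapest falsifier: the generalised GP engine (ideallog at `𝔭^49` in degree 24) on the same 18 curves, or one more `a₂ = 0` curve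
with a different plane on a level-3 class. [cite: Kramer1981, Prop. 4] [cite: Kobayashi2003]
REF1-AUDIT §190-add: **SURVIVES** (data-law, typed faithfully: `c` a root of the Eisenstein octic with `finrank = 8` ⟹ `K = ℚ₂(c)`, `v_K(c) = 1`); since -imc
§10.98-add4 (INBOX 11:40:11Z) TWO-ENGINE: GP engine 2‴ `k57b.gp` 4effa72ba758c970 (ideallog frame on `(𝒪_F/𝔭⁴⁹)^×`) j330462, 18 curves, 1 024/1 024 saturated, vs
`atlas57.py` j330261 — frame maps rank 10/10 & 26/26, planes AGREE 18 432/18 432, DISAGREE 0 (the docstring's «one engine» caveat predates add4).  **REF1 §192 (g18) re-score: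
SURVIVES as a TWO-ENGINE data-law**; BC7: the octic IS `(x² − 2)^{∘3}` (kernel `octic_is_third_iterate`, by `ring`), Eisenstein ⟹ `c` a uniformiser.  NOTE (REF1 §190-add (2)):
the «differ» direction of the `↔` is a NEGATED `KummerImagesAgree` and uses `algK W′ ≅ K(∛2)` (P54t-tower).  REF1's partial regularity (cross-check for O-57u, not a law):
every I₀* unit level set is sensitive and every II* unit level set blind (9/9 over `n ≤ 3`), type II goes both ways.  REF2-PLACEMENT v53 §7.1–7.3: NOT IN PRINT; the
s/Kodaira dictionary is dead (ℓ = 5, type II, sensitive); the companion norm-index law (N₃) = P57N (not typed here) is a COROLLARY-CANDIDATE of the PRINTED filtration METHOD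
(v53 §7.2-add/add2, D-imc-56-R5 FINAL: Serre, Corps locaux V §3 / [cite: Hazewinkel1974NormMapsI, §2, Prop. 3.1, Thm. 6.1] / [cite: Kramer1981, Prop. 4] = the `e = 1` instance;
units: `i = 2⌈(f − 2)/6⌉`, odd classes: `i = J_{n+1}` (Jacobsthal 1, 1, 3, 5, 11, …), type-, class- and BSD-independent because every leading coefficient lies in `𝔽₂ˣ = {1}`;
general-`e` statement not located in print; [cite: Kuriya2005, Thm. 1.1, Remark 1.7]; [cite: KuriharaOtsuki2006, Prop. 1.4]: `i(k₄/k₃) = 5 = q₄` confirmed on all 512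
conductor-17 extensions). -/
def LayerThreeUnitTwistTypeLawAtTwo : Prop :=
  ∀ (W₁ W₂ : WeierstrassCurve ℚ) [W₁.IsElliptic] [W₂.IsElliptic] [W₁.IsGloballyMinimal] [W₂.IsGloballyMinimal],
    GoodSS W₁ 2 → GoodSS W₂ 2 → (W₁.frobeniusTrace 2 : ZMod 4) ≠ (W₂.frobeniusTrace 2 : ZMod 4) →
  ∀ (K : Type) [Field K] [CharZero K] [Algebra ℚ_[2] K], Module.finrank ℚ_[2] K = 8 →
  ∀ c : K, c ^ 8 - 8 * c ^ 6 + 20 * c ^ 4 - 16 * c ^ 2 + 2 = 0 →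
  ∀ δ : K, δ ≠ 0 → Even ((Algebra.norm ℚ_[2] δ).valuation) →
  ∀ (W₁' W₂' : WeierstrassCurve K) [W₁'.IsElliptic] [W₂'.IsElliptic],
    (∃ C : VariableChange K, C • (W₁.baseChange K).quadraticTwist δ = W₁') →
    (∃ C : VariableChange K, C • (W₂.baseChange K).quadraticTwist δ = W₂') →
    (KummerImagesAgree W₁' W₂' ↔ IsTypeBlindLevelAtLayerThree c δ)

/-- **P57O `LayerThreeOddTwistTypeSensitiveAtTwo` (DATA-LAW, one engine, j330261: all 512 odd classes, 18 curves; this is the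
`n = 3` instance that KILLS the alternation candidate P56S `OddTwistTypeBlindIffOddLayerAtTwo 3`).**  At layer three every
ODD-valuation twist class separates the two supersingular types: for `W₁, W₂` of different type the Kummer images of the
`δ`-twists differ (32 distinct planes per type among the 512 odd classes).  Pattern over `n = 0,1,2,3`: sensitive, blind,
sensitive, sensitive — the layer-one blindness of the odd classes is so far an isolated phenomenon, not an alternation.
Why it might fail: one engine; an odd class missed by the random unit sample cannot occur (all 1 024 buckets saturated on every
curve), but a systematic descent error on odd classes would flip the whole verdict — the GP engine is the check.
Cheapest falsifier: GP ideallog planes for `δ₄ = 2 + c` on one curve pair (19a1, 11a1). [cite: Kobayashi2003] [cite: Kramer1981, Prop. 4]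
REF1-AUDIT §190-add: **SURVIVES** (data-law; this is the instance that makes P56S `OddTwistTypeBlindIffOddLayerAtTwo 3` FALSE — P56S and P55t
`LayerTwoTowerGeneratorKummerUniversalAtTwo` are NEGATIVE RECORDS and are not filed; REF1's pre-registered §190 (v)(β) «odd classes blind at n = 3» was refuted by the
same data, 512/512); two engines since §10.98-add4 (GP k57b.gp j330462 ‖ atlas57.py j330261, 0 disagreements; the docstring's «one engine» caveat predates add4).  **REF1 §192 (g18)
re-score: SURVIVES as a TWO-ENGINE data-law** (k57b.gp ‖ atlas57.py 18 432/18 432).  NOTE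
(REF1 §190-add (2)): `¬ KummerImagesAgree` ENTAILS `Nonempty (algK W₁′ →ₐ[K] algK W₂′)` — uses `algK W′ ≅ K(∛2)` (P54t-tower), load-bearing for a prover.
REF2-PLACEMENT v53 §7.1: NOT IN PRINT; the odd classes of `ℚ_{2,3}` are Kodaira II* (`s = 16`) [cite: WangHaiyang2024, Thm. 1.2] yet SENSITIVE — the witness that
retracted the (F3) dictionary; their norm index `i = 5` on all 512 conductor-17 classes is the data-law (N₃) — [cite: KuriharaOtsuki2006, Prop. 1.4] is print for the
cyclotomic STEP `k₄/k₃` only (REF2 v53 §9 nuance) — now EXPLAINED by v53 §7.2-add2: `i = J_{n+1} = #{odd K_n-levels < ⌊4e/3⌋ + 1}` (Jacobsthal), corollary-candidate of the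
printed filtration method. -/
def LayerThreeOddTwistTypeSensitiveAtTwo : Prop :=
  ∀ (W₁ W₂ : WeierstrassCurve ℚ) [W₁.IsElliptic] [W₂.IsElliptic] [W₁.IsGloballyMinimal] [W₂.IsGloballyMinimal],
    GoodSS W₁ 2 → GoodSS W₂ 2 → (W₁.frobeniusTrace 2 : ZMod 4) ≠ (W₂.frobeniusTrace 2 : ZMod 4) →
  ∀ (K : Type) [Field K] [CharZero K] [Algebra ℚ_[2] K], Module.finrank ℚ_[2] K = 8 →
  ∀ c : K, c ^ 8 - 8 * c ^ 6 + 20 * c ^ 4 - 16 * c ^ 2 + 2 = 0 →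
  ∀ δ : K, IsOddClassAtTwo δ →
  ∀ (W₁' W₂' : WeierstrassCurve K) [W₁'.IsElliptic] [W₂'.IsElliptic],
    (∃ C : VariableChange K, C • (W₁.baseChange K).quadraticTwist δ = W₁') →
    (∃ C : VariableChange K, C • (W₂.baseChange K).quadraticTwist δ = W₂') →
    ¬ KummerImagesAgree W₁' W₂'

/-- **P57L `TowerUnitTwistLevelLawAtTwo n` (CONJECTURE-CANDIDATE «on even classes the signed object at 2 is the LEVEL PROFILE»;
data-law for `n ≤ 3`: `n = 0` all 4 unit classes blind (THM B/C of D-imc-54), `n = 1` blind iff `ℓ ≠ 1` (laws U1/U2/D, two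
engines), `n = 2` blind iff `ℓ ≠ 5` (two engines, 547 712 cells), `n = 3` P57U (one engine)).**  At every layer `K = ℚ_{2,n}`,
whether the Kummer images of the `δ`-twists of two good supersingular curves agree depends, for unit classes `δ`, only on the
position of `δ` in the filtration `U^{(k)}K^{×2}/K^{×2}` (`c` any uniformiser): two unit classes with the same level profile
are simultaneously blind or sensitive.  Why it might fail: from layer four on, the verdict could depend on two leading digits of
`δ` (the level sets of `ℚ_{2,4}` have up to 2¹⁶ classes), or on `δ` modulo the norm subgroup of `ℚ_{2,4}(∛2)`.
Cheapest falsifier: the layer-4 atlas (`[F:ℚ₂] = 48`, 2¹⁸ classes — beyond the python engine; GP feasible?) or, cheaper, a proof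
/ disproof of the `n = 3` law from the explicit formal groups (Honda type `u = a₂`). [cite: Kobayashi2003] [cite: Kramer1981, Prop. 4]
REF1-AUDIT §190-add: **SURVIVES as CONJECTURE-CANDIDATE** (`n ≤ 3` data; typed faithfully: `v₂(N c) = 1` ⟹ `f = 1` and `v_K(c) = 1`; the level profile of a unit
class = its leading level; `n = 0` consistent with THM B/C of D-imc-54 since all 4 unit classes are blind) — the one `@[conjecture]` row of this module.  REF2-PLACEMENT v53
§7.2/§7.3: NOT IN PRINT; O-57u («one empirical function `V(u)` of the absolute upper break `u = φ_{K_n/ℚ₂}(f − 1)`») is an unplaced OBSERVATION whose confrontation with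
torsion-field breaks is print-computable for `a₂ = 0` (Lubin–Tate group of `ℚ₄` for `ϖ = −2`: [cite: Honda1970, Thm. 9], Hill 1971 (bib `Hill1971`), Lubin–Tate 1965 (bib `LubinTate1965`); breaks
`0, 1, …, k−1` for `E[2^k]`) and an engine computation for `a₂ = ±2`; division-field ramification bounds Lozano-Robledo 2016 (bib `LozanoRobledo2016`) cite-only. -/
@[conjecture] def TowerUnitTwistLevelLawAtTwo (n : ℕ) : Prop :=
  ∀ (W₁ W₂ : WeierstrassCurve ℚ) [W₁.IsElliptic] [W₂.IsElliptic] [W₁.IsGloballyMinimal] [W₂.IsGloballyMinimal],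
    GoodSS W₁ 2 → GoodSS W₂ 2 →
  ∀ (K : Type) [Field K] [CharZero K] [Algebra ℚ_[2] K], IsCyclotomicLayerAtTwo n K →
  ∀ c : K, (Algebra.norm ℚ_[2] c).valuation = 1 →
  ∀ δ₁ δ₂ : K, δ₁ ≠ 0 → δ₂ ≠ 0 → Even ((Algebra.norm ℚ_[2] δ₁).valuation) → Even ((Algebra.norm ℚ_[2] δ₂).valuation) →
    (∀ k : ℕ, InUnitFiltrationSqAtTwo c k δ₁ ↔ InUnitFiltrationSqAtTwo c k δ₂) →
  ∀ (W₁' W₂' W₁'' W₂'' : WeierstrassCurve K) [W₁'.IsElliptic] [W₂'.IsElliptic] [W₁''.IsElliptic] [W₂''.IsElliptic],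
    (∃ C : VariableChange K, C • (W₁.baseChange K).quadraticTwist δ₁ = W₁') →
    (∃ C : VariableChange K, C • (W₂.baseChange K).quadraticTwist δ₁ = W₂') →
    (∃ C : VariableChange K, C • (W₁.baseChange K).quadraticTwist δ₂ = W₁'') →
    (∃ C : VariableChange K, C • (W₂.baseChange K).quadraticTwist δ₂ = W₂'') →
    (KummerImagesAgree W₁' W₂' ↔ KummerImagesAgree W₁'' W₂'')

/-! ## D-imc-57 (layer four, `K = ℚ_{2,4}`, `e = 16`, 2¹⁸ classes; TARGETED GP atlas k58.gp, one engine) — typed additions -/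

/-- `IsLeadingOddLevelAtTwo c ℓ δ`: `ℓ` is odd and is the LEADING LEVEL of the even class `δ`: `δ ∈ U^{(ℓ)}K^{×2}` and
`δ ∉ U^{(ℓ+1)}K^{×2}` (uniformiser-independent; for `ℓ < 2e − 1` one has `U^{(ℓ+1)}K^{×2} = U^{(ℓ+2)}K^{×2}`; at `ℓ = 2e − 1`
the condition excludes the level-`2e` class `[5]`).  The quadratic character of `K(√δ)/K` then has conductor exponent
`f = 2e + 1 − ℓ`.
REF1-AUDIT §195 (D-imc-57-R1): CLEAN — the window `In ℓ ∧ ¬In (ℓ+1)` IS the leading level by even-level absorption (`bc7_layer4_levels_partition`, `decide`);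
R195c: unsatisfiable for `ℓ ≥ 2e + 1` (`U^{(2e+1)} ⊆ K^{×2}`), so `f = 2e + 1 − ℓ` is even in `[2, 2e]` whenever the predicate holds; junk polarity FLIPS relative to
`InUnitFiltrationSqAtTwo` — WITHOUT a finite `ℚ₂`-basis NO class has a leading odd level (kernel `isLeadingOddLevel_false_of_no_basis`; P58V vacuous there,
unreachable under the `IsCyclotomicLayerAtTwo` binders). -/
def IsLeadingOddLevelAtTwo {K : Type} [Field K] [Algebra ℚ_[2] K] (c : K) (ℓ : ℕ) (δ : K) : Prop :=
  Odd ℓ ∧ InUnitFiltrationSqAtTwo c ℓ δ ∧ ¬ InUnitFiltrationSqAtTwo c (ℓ + 1) δ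

/-- Layer-four blind levels (D-imc-57 data, 4 curves, ≈ 12 classes per level): leading odd level `ℓ ∈ {7, 13, 19, 25, 27}`, or
`δ ∈ U^{(31)}K^{×2}` (the classes `1, [−1], [5], [−5]`).
REF1-AUDIT §195: CLEAN — blind odd levels `{7, 13, 19, 25, 27}` and sensitive `{1, 3, 5, 9, 11, 15, 17, 21, 23, 29}` PARTITION the odd levels below 31 (`decide`);
square classes blind (kernel `isTypeBlindLevelAtLayerFour_sq`); junk: TRUE for every `δ` without a finite basis (kernel `isTypeBlindLevelAtLayerFour_of_no_basis`) — P58U is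
protected by its `finrank = 16` binder. -/
def IsTypeBlindLevelAtLayerFour {K : Type} [Field K] [Algebra ℚ_[2] K] (c δ : K) : Prop :=
  IsLeadingOddLevelAtTwo c 7 δ ∨ IsLeadingOddLevelAtTwo c 13 δ ∨ IsLeadingOddLevelAtTwo c 19 δ ∨
    IsLeadingOddLevelAtTwo c 25 δ ∨ IsLeadingOddLevelAtTwo c 27 δ ∨ InUnitFiltrationSqAtTwo c 31 δ

/-- **P58U `LayerFourUnitTwistTypeLawAtTwo` (DATA-LAW, ONE engine, TARGETED: k58.gp jobs j330536 (19a1), j330651 (35a1),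
j330537 (67a1), j330652 (11a1); 209 target classes, 170 saturated (rank 16) on all four curves, the rest decided by subspace
sums; verdict constant on every level set: sensitive at `ℓ ∈ {1,3,5,9,11,15,17,21,23,29}`, blind at `ℓ ∈ {7,13,19,25,27}` and on
`U^{(31)}K^{×2}`).**  For good supersingular `W₁, W₂ /ℚ` of DIFFERENT type (`a₂ ≢ a₂'` mod 4), `K = ℚ_{2,4}` (`[K:ℚ₂] = 16`,
`c = 2cos(π/32)`) and an even class `δ`, the Kummer images of the `δ`-twists agree iff `IsTypeBlindLevelAtLayerFour c δ`.
Why it might fail: one engine; ≈ 12 sampled classes per level out of up to 2¹⁵ (a second leading digit could matter on unsampled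
classes); 39 of 209 targets decided on partial planes (rank 13–15) by the subspace-sum test.  Cheapest falsifier: rerun k58.gp with
fresh target seeds (JOB_SEED of the setup) — any level whose verdict splits kills the law. [cite: Kramer1981, Prop. 4] [cite: Kobayashi2003]
REF1-AUDIT §195: **SURVIVES (DATA-LAW, ONE engine)** — the frame is literally `IsCyclotomicLayerAtTwo 4` (kernel `bc7_layer4_poly`: the typed degree-16 polynomial IS the
4-fold iterate of `x ↦ x² − 2`, `ring`; `bc7_P58U_frame_is_layer4`); BC5 recount of FOLD-58 (209 targets): 170 full + 36 subspace-sum + 3 undecided (2 at `ℓ = 1 = f = 32`,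
1 odd); unit levels 178/181 decided, 0 exceptions; R195a: a second engine should SATURATE `ℓ = 1` (`f = 32` is P58V's boundary case and rests on 4/12 full-rank targets)
and add ≥ 1 curve per type; R195b wording 170 + 36 + 3.  REF2-PLACEMENT v53 §11 (552b5be54d3eb547): the verdict-by-conductor function `V(f)` is an **UNPLACED DATA-LAW**
— no printed source compares the twisted Kummer Lagrangians of the two height-2 Honda types ([cite: Hazewinkel1974NormMapsI, Thm. 6.1] = composite norm images only;
[cite: Kobayashi2003] / Iovita–Pollack / Kitajima–Otsuki / B. D. Kim = ± norm groups of ONE formal group; [cite: KuriharaOtsuki2006, Prop. 1.4] = `s₂`-growth; corpus +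
galaxy searches logged in v53 §11.2); the accompanying norm indices (N₄) `i(f) = 2⌈(f−2)/6⌉` on all 15 unit levels + `i_odd = 11 = J₅` are EXACTLY REF2 §7.2-add/add2's
pre-registered leading-order filtration count (16/16, type-independent, no free parameter).
  TYPER FOLD (-ty g18, add3 R4 / REF2 v53 §15.2): **now TWO ENGINES on SEVEN curves** — engine 3 `atlas5/k59.gp` (targeted-twist point construction; kit j331384: 19a1, 35a1,
163a1 ‖ 67a1, 11a1, 43a1, 91a1, 108/115 targets rank 16 in all seven, every unit level SATURATED, type law 108/108, sign-blind 108/108, verdicts identical) vs k58 class by class: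
**149 both-full planes IDENTICAL, 0 disagree; 55 one-side-partial NESTED, 0 inconsistent** (`XCHECK-59-vs-58-final.txt` f39f720ce811ab36; MEMO-imc §10.99-add2/add3) — R195a served. -/
def LayerFourUnitTwistTypeLawAtTwo : Prop :=
  ∀ (W₁ W₂ : WeierstrassCurve ℚ) [W₁.IsElliptic] [W₂.IsElliptic] [W₁.IsGloballyMinimal] [W₂.IsGloballyMinimal],
    GoodSS W₁ 2 → GoodSS W₂ 2 → (W₁.frobeniusTrace 2 : ZMod 4) ≠ (W₂.frobeniusTrace 2 : ZMod 4) →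
  ∀ (K : Type) [Field K] [CharZero K] [Algebra ℚ_[2] K], Module.finrank ℚ_[2] K = 16 →
  ∀ c : K, c ^ 16 - 16 * c ^ 14 + 104 * c ^ 12 - 352 * c ^ 10 + 660 * c ^ 8 - 672 * c ^ 6 + 336 * c ^ 4 - 64 * c ^ 2 + 2 = 0 →
  ∀ δ : K, δ ≠ 0 → Even ((Algebra.norm ℚ_[2] δ).valuation) →
  ∀ (W₁' W₂' : WeierstrassCurve K) [W₁'.IsElliptic] [W₂'.IsElliptic],
    (∃ C : VariableChange K, C • (W₁.baseChange K).quadraticTwist δ = W₁') →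
    (∃ C : VariableChange K, C • (W₂.baseChange K).quadraticTwist δ = W₂') →
    (KummerImagesAgree W₁' W₂' ↔ IsTypeBlindLevelAtLayerFour c δ)

/-- **P58V `TowerTwistConductorLawAtTwo` (CONJECTURE-CANDIDATE «on even classes the signed object at 2 is the CONDUCTOR
EXPONENT of the twisting character»; supported by ALL layer data n ≤ 4: writing `f = 2e_n + 1 − ℓ(δ)`, the verdict tables of
layers 1–4 define ONE function `V(f)` with NO clash on the 8 conductor exponents shared between layers (20 (layer, level) cells:
f = 2 B⁵ (n = 0..4), 4 S⁴, 6 B³, 8 B³, 10 S², 12 S², 14 B², 16 S²) and `V` = B at `f ∈ {0, 2, 5, 6, 8, 9, 14, 20, 26}`, S at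
`f ∈ {3, 4, 10, 12, 16, 17, 18, 22, 24, 28, 30, 32, 33}` for `f ≤ 33` (odd `f = 2e_n + 1` = the odd classes of layer n: 3 S, 5 B, 9 B, 17 S, 33 S); the level law P57L inside one layer is the special case `n = n'`).**
Across layers `K = ℚ_{2,n}`, `K' = ℚ_{2,n'}`: two even classes `δ ∈ K`, `δ' ∈ K'` whose quadratic characters have the same
conductor exponent (`2·2^n + 1 − ℓ = 2·2^{n'} + 1 − ℓ'`) are simultaneously type-blind or type-sensitive.
Why it might fail: `f = 32` is S at layer 4 (`ℓ = 1`, the layer's maximal unit conductor) although `f ≡ 2 (mod 6)` like the blind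
`8, 14, 20, 26` — if `V(32)` at layer 5 (`ℓ = 33`, not maximal) turned out B, the law dies exactly at the boundary classes `ℓ = 1`;
one engine at layer 4.  Cheapest falsifier: layer 5 is out of reach (2³⁴ classes); instead a PROOF ATTEMPT: express the verdict
through Hazewinkel's norm-map breaks of the two Honda types over `K_n(√δ)` — a clash with the table kills it. [cite: Kobayashi2003]
[cite: Kramer1981, Prop. 4]
REF1-AUDIT §195: **SURVIVES as CONJECTURE-CANDIDATE** (`@[conjecture]` on port per R195c — applied) — subtraction-free conductor matching `2·2^n + ℓ' = 2·2^{n'} + ℓ` ✓,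
same curve pair on both layers ✓, unbounded layers = the prediction ✓; consistent with every typed lower-layer predicate (kernel `bc7_layer34_noClash`, `decide` 8/8 for
layers 3/4; layers 0–2 on paper); the `n = n'` case is the level law P57L (kernel `bc7_conductor_same_layer`).  REF2-PLACEMENT v53 §11: `V(f)` UNPLACED (above); **PROVED
CORNER (v53 §11 (3), recorded at REF2's request): `i(f) = 0 ⟹ Π_δ ⊇ Π_1 ⟹ Π_δ = Π_1 ⟹ blind` (given `δ = 1` blind by the type law) — explains `V(0) = V(2) = B` at all five
layers**; for `i > 0`, `Π_δ` is a Lagrangian through the isotropic `W_δ = Π_1 ∩ Π_δ` (dim `2^n − i`), a point of `LGr(W_δ^⊥/W_δ)` of dimension `2i` — the leading-order count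
fixes `dim W_δ` type-blindly and is silent on position, which is where `a₂ mod 4` enters via SUB-LEADING coefficients of `[2]_Ê` / of `F(y,−y) = a₃y⁴ + …`; the observed
`f mod 6` correlate (f ≡ 4: S 8/8; f ≡ 2: B 10/11, exception f = 32; f ≡ 0: S except f = 6) is explicitly NOT proposed as `V`'s closed form (two exceptions).  -imc D-imc-57:
O-57u (absolute-upper-break reading) KILLED 9/12 (`ℓ = 27` B, `ℓ = 23` S at layer 4); the conductor reading has no clash on the 8 even `f` shared between layers (21 cells).
  TYPER FOLD (-ty g18, add3 R4): **P58V SURVIVED ITS CHEAPEST FALSIFIER** — layer 5 (`ℚ_{2,5}`, `e = 32`, engine 3, kit j331383 + replication j331499 + four more curves j331548):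
`f = 32` (`ℓ = 33`, not a top-of-layer class) is TYPE-VISIBLE (S on 8/8 + 6/6 fresh classes, `i = 10`); `V(f)` is now ONE function on **37 (layer, f) coincidence cells, 0 clash**
(21 through layer 4 + the 16 even `f ≤ 32` at layer 5); the «`f mod 6`» reading is DEAD (S at `f = 32, 38, 44, 50, 56, 62`); updated table B = `{0, 2, 5, 6, 8, 9, 14, 20, 26}`,
S = `{3, 4, 10, 12, 16, 17, 18, 22, 24} ∪ {28, 30, …, 64} ∪ {33, 65}` — SHARPENED by P59F `TowerTwistBlindConductorSetAtTwo` below (the blind conductor set looks FINITE);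
(N₅) `i(f) = 2⌈(f−2)/6⌉` 16/16 + `i_odd = 21 = J₆` as pre-registered (MEMO-imc §10.99-add3/add4).  REF2-PLACEMENT v54 §1.3: V(f) NOT IN PRINT, OPEN IN PRINT (MR15's companion problem at 2). -/
@[conjecture] def TowerTwistConductorLawAtTwo : Prop :=
  ∀ (n n' : ℕ) (W₁ W₂ : WeierstrassCurve ℚ) [W₁.IsElliptic] [W₂.IsElliptic] [W₁.IsGloballyMinimal] [W₂.IsGloballyMinimal],
    GoodSS W₁ 2 → GoodSS W₂ 2 →
  ∀ (K : Type) [Field K] [CharZero K] [Algebra ℚ_[2] K], IsCyclotomicLayerAtTwo n K →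
  ∀ (K' : Type) [Field K'] [CharZero K'] [Algebra ℚ_[2] K'], IsCyclotomicLayerAtTwo n' K' →
  ∀ (c : K) (c' : K'), (Algebra.norm ℚ_[2] c).valuation = 1 → (Algebra.norm ℚ_[2] c').valuation = 1 →
  ∀ (δ : K) (δ' : K') (ℓ ℓ' : ℕ), δ ≠ 0 → δ' ≠ 0 →
    IsLeadingOddLevelAtTwo c ℓ δ → IsLeadingOddLevelAtTwo c' ℓ' δ' → 2 * 2 ^ n + ℓ' = 2 * 2 ^ n' + ℓ →
  ∀ (W₁' W₂' : WeierstrassCurve K) (W₁'' W₂'' : WeierstrassCurve K')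
    [W₁'.IsElliptic] [W₂'.IsElliptic] [W₁''.IsElliptic] [W₂''.IsElliptic],
    (∃ C : VariableChange K, C • (W₁.baseChange K).quadraticTwist δ = W₁') →
    (∃ C : VariableChange K, C • (W₂.baseChange K).quadraticTwist δ = W₂') →
    (∃ C : VariableChange K', C • (W₁.baseChange K').quadraticTwist δ' = W₁'') →
    (∃ C : VariableChange K', C • (W₂.baseChange K').quadraticTwist δ' = W₂'') →
    (KummerImagesAgree W₁' W₂' ↔ KummerImagesAgree W₁'' W₂'')

/-! P58N (words; typing ask to -ty, needs the Kummer image as an `𝔽₂`-subspace, not only `KummerImagesAgree`): CROSS-LAYER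
NORM-INDEX LAW — for every layer `n ≤ 4` and every even class `δ` of conductor exponent `f ≤ 2e_n`, `dim Π_1 − dim(Π_1 ∩ Π_δ)
= 2⌈(f − 2)/6⌉` (type-independent), and for odd classes (`f = 2e_n + 1`) it equals the Jacobsthal number `q_{n+1}`
(1, 1, 3, 5, 11: EQUALITY in Kurihara–Otsuki 2006 Prop. 1.4's lower bound `#(F(k_{n})/N F(k_{n+1})) ≥ 2^{q_{n+1}}`); two engines
at n ≤ 3, one (targeted) at n = 4 (15 unit levels + 27 odd targets, 0 exceptions). -/

/-! ## D-imc-58 (add59 + add59b; -imc g19 MEMO-imc §10.99-add3/add4/add5): the VALUATION WINDOW of a twisted supersingular cubic over a layer of the 2-tower (P59E, P59B′, P59W′),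
LAYER FIVE and the FINITE BLIND CONDUCTOR SET (P59F), the [2]-PROFILE of the formal flag (P59D′) — appended by -ty g18 at REF1 §200's port gate (R200a repaired forms only; R200b) -/

/-- The long Weierstrass cubic in the coordinates `X = 4x`, `Y = 4(2y + a₁x + a₃)`:
`Y² = X³ + b₂X² + 8b₄X + 16b₆` with `b₂ = a₁² + 4a₂`, `b₄ = a₁a₃ + 2a₄`, `b₆ = a₃² + 4a₆`.
REF1-AUDIT §200 (A2): **CLEAN** — kernel `bc7_cubicG_weierstrass` (`ring`): `(4(2y+a₁x+a₃))² − G(4x) = 64·(y²+a₁xy+a₃y − x³−a₂x²−a₄x−a₆)`, so this IS the long Weierstrass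
equation in `X = 4x`, `Y = 4(2y+a₁x+a₃)`; the binder «`Even a₁ ∧ Odd a₃`» used below = good SUPERSINGULAR reduction at 2 exactly (`j̄ = 0`, `Δ ≡ −27b₆²` odd), whence
`v_K(b₂) ≥ 2e`, `v_K(8b₄) ≥ 4e`, `v_K(16b₆) = 4e`, `b₆ ∈ U^{(2e)}`, and `G` has NO root in any `K_n` (Newton slope `−4e/3`). -/
def cubicGAtTwo {K : Type} [Field K] (a₁ a₂ a₃ a₄ a₆ : ℤ) (X : K) : K :=
  X ^ 3 + ((a₁ ^ 2 + 4 * a₂ : ℤ) : K) * X ^ 2 + ((8 * (a₁ * a₃ + 2 * a₄) : ℤ) : K) * X + ((16 * (a₃ ^ 2 + 4 * a₆) : ℤ) : K)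

/-- **P59E `TwistPointBelowTieExistsAtTwo` (support; elementary Hensel).**  Over the layer `K = ℚ_{2,n}` (`e = 2ⁿ`), for every
integral model with `a₁` even and `a₃` odd (= good supersingular reduction at 2 up to translation), every `δ ≠ 0` and every
`q ∈ ℤ` with `3q < 4e` and `q ≡ v_K(δ) (mod 2)`, the twisted cubic `δY² = G(X)` has a solution with `v_K(X) = q`
(regime X³ of engine 3: `a = c^{3q}δ′³s⁶`, `U₀ = δ′s²`; a point for EVERY sample — lane statistics: 0 Hensel failures).
Why it might fail: only through a typo in the valuations (`v_K(b₂) ≥ 2e`, `v_K(8b₄) ≥ 4e`, `v_K(16b₆) = 4e` are what is used).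
REF1-AUDIT §200 (D-imc-58-R1; Sketch59 541377e8d466e7be = present 4cd694cf81b53af2 + the since-dropped local `IsLeadingOddLevelAtTwo`; Probe200 5c156619a4c6c199 farm rc 0):
**SURVIVES — THEOREM-GRADE support** (Hensel, 6 lines: `X = c^qU`, `G(X) = c^{3q}g(U)` with `g = U³ + εU² + ε′U + ε″`, `ε, ε′, ε″ ∈ 𝔪`, Hensel from `U₀ = 1` on the unit part of `δ`;
holds at `n = 0` too; the junk `(Algebra.norm ℚ_[2] 0).valuation = 0` only adds a harmless extra witness at `q = 0`; R200d optional hygiene `X ≠ 0 ∧` not applied — verbatim).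
REF2-PLACEMENT v54 §1.4 (28acaeae8cf1e6a2): the tie dictionary `q* = (4e+λ)/3 = 2e − t/3 ∈ ℤ ⟺ 3 ∣ t` is a RESTATEMENT of v53 §7.2's tie level in -imc's coordinates = the Kodaira
trichotomy of §2 («tie exists ⟺ f ≡ 1 (mod 3) ⟺ the twist is I₀*», [cite: WangHaiyang2024, Thm. 1.2]); nothing to place.  Port with proof when a prover takes it (known-type). -/
def TwistPointBelowTieExistsAtTwo : Prop :=
  ∀ (n : ℕ) (K : Type) [Field K] [CharZero K] [Algebra ℚ_[2] K], IsCyclotomicLayerAtTwo n K →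
  ∀ (a₁ a₂ a₃ a₄ a₆ : ℤ), Even a₁ → Odd a₃ →
  ∀ δ : K, δ ≠ 0 → ∀ q : ℤ, 3 * q < 4 * 2 ^ n → Even ((Algebra.norm ℚ_[2] δ).valuation - q) →
    ∃ X Y : K, (Algebra.norm ℚ_[2] X).valuation = q ∧ δ * Y ^ 2 = cubicGAtTwo a₁ a₂ a₃ a₄ a₆ X

/-- **P59B `TwistPointValuationBoundAtTwo` (support; elementary).**  If the unit class `δ` has EXACT level `λ < 2e`
(`δ ∈ U^{(λ)}K^{×2} ∖ U^{(λ+1)}K^{×2}`, `c` the layer uniformiser `2cos(π/2^{n+1})`), then every solution of `δY² = G(X)` with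
`Y ≠ 0` has `3·v_K(X) ≤ 4e + λ`: for larger `v_K(X)`, `G(X) = 16b₆(1 + ρ)` with `v_K(ρ) > λ` and `b₆ ≡ 1 (mod 4)`, so `δ = G(X)/Y²`
would lie in `U^{(λ+1)}K^{×2}`.  This is WHY engine 2's high-conductor buckets starved (a level-λ twist has no points beyond the
tie valuation `q* = (4e+λ)/3`; conductor `f = 2e+1−λ` ⟹ `q* = 2e − (f−1)/3` = REF2 v53 §7.2's tie level `2t/3` read in `X`).
Why it might fail: as stated only if `Y = 0` were allowed (then `X` is a 2-torsion abscissa; excluded) or for `λ ≥ 2e` (the `[5]`, `[−1]` classes, excluded).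
REF1-AUDIT §200 KILL 1 + R200a (MANDATORY port gate) — **THE SKETCHED BODY IS REFUTED IN THE KERNEL** (`P59B_false`, Probe200 l.348, axioms standard: at `n = 0` the iterate
binder `(fun x => x^2-2)^[0] c = 0` FORCES `c = 0`, and then `δ = 5`, `y²+y = x³`, `X = Y = 4`, `lam = 0` gives `3·2 ≤ 4` false) and is MIS-STATED; **THIS ROW IS REF1's REPAIRED
FORM C′, typed by -ty g18: the binder `(fun x : K => x ^ 2 - 2)^[n] c = 0` is REPLACED by the uniformiser binder `(Algebra.norm ℚ_[2] c).valuation = 1` (as in P58V/P59F;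
`c` = ANY uniformiser of the layer), nothing else changed.**  C′ is THEOREM-GRADE (REF1's proof, all `n ≥ 0`): exact level 0 = the odd classes: if `3q > 4e` then `v(G(X)) = 4e` even ≠
odd ✗; even `lam ≥ 2` vacuous (even exact levels `0 < 2k < 2e` are empty); odd `lam`: if `3q > 4e + lam` then `G(X) = 16b₆(1+ρ)`, `v(ρ) ≥ lam+1` (uses `lam < 2e`), `b₆ ∈ U^{(2e)}`
⟹ `δ ∈ U^{(lam+1)}K^{×2}` ✗; the kill witness misses C′.  -imc g19/g20: confirm or re-sketch (the typer applied REF1's one-binder repair verbatim, as for R193a/R194a). -/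
def TwistPointValuationBoundAtTwo : Prop :=
  ∀ (n : ℕ) (K : Type) [Field K] [CharZero K] [Algebra ℚ_[2] K], IsCyclotomicLayerAtTwo n K →
  ∀ c : K, (Algebra.norm ℚ_[2] c).valuation = 1 →
  ∀ (a₁ a₂ a₃ a₄ a₆ : ℤ), Even a₁ → Odd a₃ →
  ∀ (δ : K) (lam : ℕ), lam < 2 * 2 ^ n → InUnitFiltrationSqAtTwo c lam δ → ¬ InUnitFiltrationSqAtTwo c (lam + 1) δ →
  ∀ X Y : K, Y ≠ 0 → δ * Y ^ 2 = cubicGAtTwo a₁ a₂ a₃ a₄ a₆ X →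
    3 * (Algebra.norm ℚ_[2] X).valuation ≤ 4 * 2 ^ n + lam

/-- **P59W `TwistPointValuationWindowAtTwo` (support/data-law; «the exact valuation window»).**  For a unit class `δ` of exact
level `λ < 2e` over `K = ℚ_{2,n}` (`n ≥ 1`) and any model with `a₁` even, `a₃` odd, the set of `v_K(X)` over the solutions of
`δY² = G(X)`, `Y ≠ 0`, is EXACTLY `{q even : 3q < 4e + λ} ∪ {(4e+λ)/3 if 3 ∣ 4e+λ}` — even valuations up to the tie, plus the
(odd) TIE valuation `q* = (4e+λ)/3` when it is an integer, i.e. iff `3 ∣ t = f − 1` (`f = 2e+1−λ`): the point-geometric form of the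
«tie level» of the norm-index mechanism.  Stated as: membership ⟺ (even ∧ below) ∨ (= tie).  Census: engine 3 at layer 4
(j331209: after admitting `q*`, the five levels `ℓ ≡ 5 (mod 6)` — exactly those with `3 ∣ 4e+ℓ` at `e = 16` — went from rank 15/16
to 16/16; 0 Hensel failures; 0 accepted samples outside the window).
Why it might fail: a cancellation inside `ρ = (S² − 1) + (δb₆ − 1)S²` producing an odd `v_K(ρ) < λ` (ruled out on paper: `v_K(S²−1)`
is even or `≥ 2e`), or `Y = 0`.
REF1-AUDIT §200 KILL 2 + R200a — **THE SKETCHED BODY IS REFUTED IN THE KERNEL** (`P59W_false`, Probe200 l.422: layer-1 model `QuadraticAlgebra ℚ_[2] 2 0 = ℚ₂(√2)` certified as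
`IsCyclotomicLayerAtTwo 1`; `lam = 0` is admitted by `lam < 2·2ⁿ` but «exact level 0» = the ODD classes, whose window is the odd one `{q odd : 3q < 4e}` (= P59E), not the typed
even-class window: `δ = c = √2`, `y²+y = x³ − 2x²`, `X = Y = √2`, `q = 1`) — MIS-STATED; **THIS ROW IS REF1's REPAIRED FORM C′, typed by -ty g18: binder `Odd lam →` PREPENDED
(equivalently `1 ≤ lam`, even positive exact levels being empty) AND the iterate binder on `c` replaced by the uniformiser binder `(Algebra.norm ℚ_[2] c).valuation = 1`
(uniformity with P59B′; immaterial here since `1 ≤ n`).**  C′ is THEOREM-GRADE — REF1 PROVED THE WHOLE WINDOW (`δ` of exact odd level `λ < 2e`, any `n ≥ 1`): ⊇ even `q`,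
`3q < 4e` by P59E's Hensel; ⊇ even `q`, `4e < 3q < 4e+λ`: `k = 3q−4e` even, `G(X) = 16b₆(1 + c^k w h(U))`, `h` takes every unit value (Hensel) and the unit `t` with
`1 + c^k t = (1 + c^λ y₀)(1 + c^{k/2})²` exists because `v(2c^{k/2}) = e + k/2 > k`; ⊇ tie `3q* = 4e+λ`: `k = λ`, `t = y₀`; ⊆: odd `q < 4e/3` ⟹ `v(G)` odd ≠ `v(δY²)` even; odd `q`
with `4e < 3q < 4e+λ` ⟹ exact level `k` odd `≠ λ`; `3q > 4e+λ` ⟹ P59B′.  Facts used: `1 + c^k t` (`t` unit, `k` odd `< 2e`) has exact level `k`; even levels absorbed;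
`U^{(2e+1)} ⊂ K^{×2}`.  Kernel `tie_levels_layer4/5`, `tie_iff_three_dvd_t` (`decide`) in `TowerKummerAtlasAtTwoKernel.lean`.  REF2 v54 §1.4: tie dictionary = restatement (see P59E). -/
def TwistPointValuationWindowAtTwo : Prop :=
  ∀ (n : ℕ), 1 ≤ n → ∀ (K : Type) [Field K] [CharZero K] [Algebra ℚ_[2] K], IsCyclotomicLayerAtTwo n K →
  ∀ c : K, (Algebra.norm ℚ_[2] c).valuation = 1 →
  ∀ (a₁ a₂ a₃ a₄ a₆ : ℤ), Even a₁ → Odd a₃ →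
  ∀ (δ : K) (lam : ℕ), Odd lam → lam < 2 * 2 ^ n → InUnitFiltrationSqAtTwo c lam δ → ¬ InUnitFiltrationSqAtTwo c (lam + 1) δ →
  ∀ q : ℤ,
    (∃ X Y : K, Y ≠ 0 ∧ (Algebra.norm ℚ_[2] X).valuation = q ∧ δ * Y ^ 2 = cubicGAtTwo a₁ a₂ a₃ a₄ a₆ X) ↔
    ((Even q ∧ 3 * q < 4 * 2 ^ n + lam) ∨ 3 * q = 4 * 2 ^ n + lam)

/-! ## Layer 5 (`ℚ_{2,5}`, `e = 32`, engine 3, kit j331383): P58V survives its cheapest falsifier; the blind set looks FINITE -/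

/-- **P59F `TowerTwistBlindConductorSetAtTwo` (CONJECTURE-CANDIDATE sharpening P58V `TowerTwistConductorLawAtTwo`; «the
type-blind twisting conductors are exactly `f ∈ {2, 6, 8, 14, 20, 26}`»).**  For good supersingular `W₁, W₂/ℚ` of DIFFERENT type
(`a₂ ≢ a₂′ mod 4`), every layer `K = ℚ_{2,n}` (`e = 2ⁿ`, `c` any uniformiser), and every class `δ` with a leading ODD level `ℓ`
(conductor exponent `f = 2e + 1 − ℓ ∈ [2, 2e]` even), the Kummer images of the `δ`-twists AGREE iff `f ∈ {2, 6, 8, 14, 20, 26}`.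
Census (every even-`f` cell of layers 0–5, 0 exceptions): layer 5 (j331383, 19a1 ‖ 67a1, 8 generic classes per level + pure odd
powers, all rank 32): B at `ℓ ∈ {39,45,51,57,59}` ∪ constants (`f = 26,20,14,8,6,2`), S at the 26 other even `f ≤ 64`; layer 4 (7 curves,
two engines): B at `ℓ ∈ {7,13,19,25,27,31}` (`f = 26,20,14,8,6,2`); layer 3: B at `ℓ ∈ {3,9,11,15}` (`f = 14,8,6,2`); layer 2: B at
`ℓ ∈ {1,3,7}` (`f = 8,6,2`); layer 1: B at `ℓ = 3` (`f = 2`), S at `ℓ = 1` (`f = 4`); layer 0: `f = 2` B.  It implies P58V on even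
classes and kills the «f mod 6» reading (S at `f = 32, 38, 44, 50, 56, 62`).
Why it might fail: layer 6 (`f ≤ 128`) could add a blind conductor `> 26` or turn one of `f ∈ [28, 64]` blind (that would also
refute P58V); one engine at layer 5 (engine 3, validated against engine 2 at layer 4 on 149/149 planes), one curve per type so far.
Cheapest falsifier: a second curve pair at layer 5 (kit j331548 queued: 35a1, 11a1, 163a1, 43a1), then layer 6 at `ℓ = 103` (`f = 26`:
predicted B) and `ℓ = 101` (`f = 28`: predicted S).
REF1-AUDIT §200: **SURVIVES as CONJECTURE-CANDIDATE** (`@[conjecture]` on port like P58V; well-typed incl. `n = 0` and the ℕ-subtraction: kernel `bc7_truncation` — for `ℓ ≥ 2e+1`,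
`2·2ⁿ+1−ℓ ∈ {0,1} ∉ S` reads «sensitive», harmless because `IsLeadingOddLevelAtTwo c ℓ δ` is unsatisfiable there; `bc7_blindSet_layers_0_1`: layer 0 ⟹ only `ℓ = 1 ↦ f = 2`
blind, layer 1 ⟹ `ℓ = 3 ↦ f = 2` blind, `ℓ = 1 ↦ f = 4` sensitive = D-imc-54 THM B/C; `blindSet_matches_layers_2_to_5` (-imc, `decide`) — all in the kernel file; the sensitive
side of `KummerImagesAgree` ENTAILS `Nonempty (algK W₁' →ₐ[K] algK W₂')` — P54t rider, §190, by reference).  R200b APPLIED by -imc (the local `IsLeadingOddLevelAtTwo` copy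
dropped; the tree's add58 decl is used).  R200c (BC5 thin cells, for the record): at layer 5 the 15 levels `ℓ ∈ {5,7,11,13,17,19,23,25,29,41,43,47,49,53,55}` rest on ONE class
each (the pure power `1 + c^ℓ`); `f ∈ {36,40,42,46,48,52,54,58,60}` has never been measured with a generic (8-class) level set at any layer; «new cells `f ∈ {34,…,64}` ALL
sensitive» is supported by generic level sets only for `f ∈ {64,62,56,50,44,38,34}` (+ `{32,30,28}`).  -imc add4 (13:16Z, kit j331548): the pre-registration for the four new
layer-5 curves PASSES — type law 158/158, sign-blind 158/158, B exactly at `f ∈ {2,6,8,14,20,26}` (three curves per type); add4 (b)/add5 (c): the TYPE DISTANCE `d(f) =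
½·codim(Π_δ(0) ∩ Π_δ(2))` is constant per level and layer-independent (18/18 shared conductors, `ℓ ≥ 5`), stable values `f = 2..56`: 0,1,0,0,1,1,0,1,1,0,2,1,0,2,1,1,2,1,1,2,2,
1,2,2,1,3,2,2 — `B = {f : d(f) = 0}`; add5 (a): the isotropic core `W_δ = Π_1 ∩ Π_δ` is TYPE-BLIND 333/333 (layers 3–5), (e): «type 2 minus type 0 in cell δ» is an ALTERNATING
form `Q_δ` of rank `2d(f)` on `E(K)/N_{L/K}E(L)` (R200e: the even-rank step is correct); add6 (14:01Z): norm-depth law O-59m 43/43, Tate pairing in the frame 208/208 planes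
isotropic, `Q_δ` non-alternating only at `f = 2e` (O-59a) — words, not typed here.  LIVE FALSIFIER: layer-6 probe kit j331619 (`f = 26` ⟹ B, `28/32/38` ⟹ S; `d = 0, 2, 1, 1`).
REF2-PLACEMENT v54 §1 (28acaeae8cf1e6a2; companion currency): P56T ∀n + P57P = «`a₂ ≡ a₂′ (mod 4)` ⟹ `E₁, E₂` are LOCAL 2-SELMER COMPANIONS AT 2 over every cyclotomic layer and
every quadratic twist»; P59F / V(f) / d(f) quantify the converse.  **§1.3 VERDICT: NOT IN PRINT; OPEN IN PRINT** = the `p = 2`, `k = 1`, good-supersingular instance of Mazur–Rubin's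
open problem [cite: MazurRubin2015SelmerCompanions, §1] («necessary and sufficient conditions for p-companionship … the local condition at p … under twists … in terms of finite
congruence information»; still open per [cite: SelmerCompanionForms2025, Rem. 4]); in KODAIRA CURRENCY (§2, [cite: WangHaiyang2024, Thm. 1.2]: `Kod(E^{(δ)} ⊗ K) = II / I₀* /
II*` iff `f ≡ 0 / 1 / 2 (mod 3)`): blind = `{f = 2} ∪ {the II-class f = 6} ∪ {the II*-classes f = 8, 14, 20, 26}`, sensitive = all I₀*-classes, II from `f = 12`, II* from `f = 32`,
all odd classes; §2.4: the complete classical local profile of a twist (Kodaira, `m`, `c`, `v(Δ_min)`, conductor, all norm indices — [cite: Kramer1981, Prop. 7] frame,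
[cite: KramerTunnell1982, Thm. 7.6] index) is a function of `f` ALONE, type-and-sign-free, so NO Tate-algorithm or norm-index invariant separates the types: the two thresholds 12
and 32 are the cell's; §3: sign-blindness ∀n is a COROLLARY OF PRINT (|𝔽₂| = 2 kills the Tamagawa check).  Beyond-print theorem candidate (REF2): the type law itself as a `p = 2`
supplement to MR15 Thm 3.1/29 — a local Selmer-structure theorem, not BSD; P59F as stated = data-law (n ≤ 5) / conjecture-candidate beyond.  PARTITION none; BSD not proved. -/
@[conjecture] def TowerTwistBlindConductorSetAtTwo : Prop :=
  ∀ (n : ℕ) (W₁ W₂ : WeierstrassCurve ℚ) [W₁.IsElliptic] [W₂.IsElliptic] [W₁.IsGloballyMinimal] [W₂.IsGloballyMinimal],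
    GoodSS W₁ 2 → GoodSS W₂ 2 → (W₁.frobeniusTrace 2 : ZMod 4) ≠ (W₂.frobeniusTrace 2 : ZMod 4) →
  ∀ (K : Type) [Field K] [CharZero K] [Algebra ℚ_[2] K], IsCyclotomicLayerAtTwo n K →
  ∀ c : K, (Algebra.norm ℚ_[2] c).valuation = 1 →
  ∀ (δ : K) (ℓ : ℕ), δ ≠ 0 → IsLeadingOddLevelAtTwo c ℓ δ →
  ∀ (W₁' W₂' : WeierstrassCurve K) [W₁'.IsElliptic] [W₂'.IsElliptic],
    (∃ C : VariableChange K, C • (W₁.baseChange K).quadraticTwist δ = W₁') →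
    (∃ C : VariableChange K, C • (W₂.baseChange K).quadraticTwist δ = W₂') →
    (KummerImagesAgree W₁' W₂' ↔ 2 * 2 ^ n + 1 - ℓ ∈ ({2, 6, 8, 14, 20, 26} : Finset ℕ))

/-- The `X`-coordinate duplication numerator in the coordinates `X = 4x`: `x(2P) = (x⁴ − b₄x² − 2b₆x − b₈)/(4x³ + b₂x² + 2b₄x + b₆)`
becomes `X(2P) = (X⁴ − 16b₄X² − 128b₆X − 256b₈)/(4·G(X))`, `b₈ = a₁²a₆ + 4a₂a₆ − a₁a₃a₄ + a₂a₃² − a₄²`.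
REF1-AUDIT §200 (A2): **CLEAN** — kernel `bc7_dupNum_coords` (`= 256·(x⁴ − b₄x² − 2b₆x − b₈)` at `X = 4x`) and `bc7_dupDen_coords` (`16·(4x³+b₂x²+2b₄x+b₆) = G(4x)`), so
`X([2]P) = dupNum(X)/(4G(X)) = dupNum(X)/(4Y²)` is [cite: SilvermanAEC2009, III.2.3(d)] verbatim. -/
def dupNumAtTwo {K : Type} [Field K] (a₁ a₂ a₃ a₄ a₆ : ℤ) (X : K) : K :=
  X ^ 4 - ((16 * (a₁ * a₃ + 2 * a₄) : ℤ) : K) * X ^ 2 - ((128 * (a₃ ^ 2 + 4 * a₆) : ℤ) : K) * X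
    - ((256 * (a₁ ^ 2 * a₆ + 4 * a₂ * a₆ - a₁ * a₃ * a₄ + a₂ * a₃ ^ 2 - a₄ ^ 2) : ℤ) : K)

/-- **P59D `PointDoublingValuationAtTwo` (support; elementary — the valuation form of `v([2]t) = min(4·v(t), v(t) + e)` for the
height-2 formal group at 2).**  Over `K = ℚ_{2,n}` (`e = 2ⁿ`), model with `a₁` even, `a₃` odd: a point `(X, Y)` of `Y² = G(X)`, `Y ≠ 0`,
with `v_K(X) = q < 2e` (formal level `m = e − q/2` when `q` is even and `≤ 2e − 2`) doubles to `X₂ = dupNum(X)/(4Y²)` with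
`v_K(X₂) = q − 2e` if `3q < 4e` (level `m ↦ m + e`, the `2t` term wins) and `v_K(X₂) = 4q − 6e` if `3q > 4e` (level `m ↦ 4m`, the `t⁴` term
wins).  CONSEQUENCE seen in the data (engine 3 filtration mode, kit j331697, layer 4, four curves of both types): the Kummer images
`F_m := κ(Ê(𝔭^m)) ⊂ Π_1` lose exactly one dimension per level except at the DOUBLED levels `m ∈ {4j : 3j < e} ∪ {j + e : 3j > e}` —
observed stalls at `m = 4, 8, 12, 16` in the window `m ≤ 20`, `dim Π_1 = #{surviving levels} = e` — and the whole flag `(F_m)_m` is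
CURVE-INDEPENDENT (20/20 pieces equal on 19a1, 35a1, 67a1, 11a1).  Why it might fail: only by a slip in `v_K(16b₄X²) ≥ 4e + 2q`,
`v_K(128b₆X) = 7e + q`, `v_K(256b₈) ≥ 8e` versus `v_K(X⁴) = 4q` (needs `q < 2e`), and `v_K(4G(X)) = 2e + min(3q, 4e)` off the tie `3q = 4e`.
REF1-AUDIT §200 KILL 3 + R200a — **THE SKETCHED BODY IS REFUTED IN THE KERNEL** (`P59D_false`, Probe200 l.454: `n = 0`, `y²+y = x³`, the 3-torsion point `(X,Y) = (0,4)`,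
`q = 0 < 2` ADMITTED through the junk `(Algebra.norm ℚ_[2] 0).valuation = 0`; clause 1 demands valuation `−2`, actual junk `0`) — MIS-STATED (junk value at `X = 0`; morally
`v(X) = +∞` is outside `q < 2e`); **THIS ROW IS REF1's REPAIRED FORM C′, typed by -ty g18: binder `X ≠ 0 →` PREPENDED, nothing else changed.**  C′ is THEOREM-GRADE (REF1, all
`n ≥ 0`, all `q < 2e` incl. negative): `v(X⁴) = 4q` STRICTLY below `v(16b₄X²) ≥ 5e+2q`, `v(128b₆X) = 7e+q`, `v(256b₈) ≥ 8e` (each ⟺ `q < 2e`), so `v(dupNum X) = 4q`; `v(4Y²) =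
2e + v(G(X))` with `v(G(X)) = 3q` if `3q < 4e` and `= 4e` if `3q > 4e` ⟹ `v(X₂) = q − 2e`, resp. `4q − 6e` ✓ (= `v([2]t) = min(4v(t), v(t)+e)` at `t`-level `m = e − q/2`).
Kernel `doubledLevels_layer4` (`decide`; `{4,8,12,16,20}`; the stall at `m = 20` is invisible inside the window `m ≤ 20`, consistent with «observed 4, 8, 12, 16»).  -imc add6 (a):
layer-5 formal flag EXACTLY as pre-registered (j331842; stalls at `m ≡ 0 (mod 4)`, total 32; 40/40 curve-independent).  REF2-PLACEMENT v54 §9.2 (O-59m, words in add5 (b)/add6):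
the norm-depth law `m₀(f) = 4⌈(u−1)/3⌉ − [u ≡ 2 (3)]` and the flag profile are COROLLARIES OF PRINT ([cite: Hazewinkel1974NormMapsI, §2.4] Lemma 2.4.1 / Cor. 2.4.2 + Serre CL V §3;
REF2 desk derivation 116/116, `HOME/REF2-O59m-derivation.md`) — to be typed as THEOREM-candidates when -imc sketches them (not typed here). -/
def PointDoublingValuationAtTwo : Prop :=
  ∀ (n : ℕ) (K : Type) [Field K] [CharZero K] [Algebra ℚ_[2] K], IsCyclotomicLayerAtTwo n K →
  ∀ (a₁ a₂ a₃ a₄ a₆ : ℤ), Even a₁ → Odd a₃ →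
  ∀ X Y : K, X ≠ 0 → Y ≠ 0 → Y ^ 2 = cubicGAtTwo a₁ a₂ a₃ a₄ a₆ X → ∀ q : ℤ, (Algebra.norm ℚ_[2] X).valuation = q → q < 2 * 2 ^ n →
    (3 * q < 4 * 2 ^ n → (Algebra.norm ℚ_[2] (dupNumAtTwo a₁ a₂ a₃ a₄ a₆ X / (4 * Y ^ 2))).valuation = q - 2 * 2 ^ n) ∧
    (4 * 2 ^ n < 3 * q → (Algebra.norm ℚ_[2] (dupNumAtTwo a₁ a₂ a₃ a₄ a₆ X / (4 * Y ^ 2))).valuation = 4 * q - 6 * 2 ^ n)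

end Summit.BirchSwinnertonDyer.Rank1Residual.F1Sign2

end
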